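import Literature.NumberTheory.Sieve.DrappeauDispersionS1Gcd
import Literature.NumberTheory.Sieve.DrappeauDispersionR1Reduction
import Literature.NumberTheory.Sieve.PowerfulPartDecomposition
import HarnessLib

/-!
# Drappeau 2017, §5.4: the second reduction — `ℛ₁` from its pieces with small `(q₀, n₀)`

Topic `Literature/NumberTheory/Sieve`, part of the formalisation of §5 of S. Drappeau, Proc. London
Math. Soc. (3) 114 (2017) 684–732 = arXiv:1504.05549 (Theorem 5.1 = the named fact
`Literature.NumberTheory.Sieve.Drappeau2017_theorem51`).  Everything here is PROVED; no definition
and no named fact is introduced.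

§5.4 of the paper (arXiv p. 19–20): "For all integers `q₀, n₀` with `(n₀, q₀) = 1`, let `𝒮₁(q₀,n₀)`
denote the contribution to `𝒮₁` of those integers satisfying `(q₁,q₂) = q₀` and `(n₁,n₂) = n₀`. …
Therefore, for some `δ > 0` and all `1 ≤ K ≤ x^δ`, `∑_{max{q₀,n₀} > K} |𝒮₁(q₀,n₀)| ≪ x^ε MN²K^{−1}`
… By choosing `K` appropriately, it will therefore suffice to show that
`𝒮₁(q₀,n₀) = α̂(0)X₁(q₀,n₀) + O(MN²x^{−δ})` (`q₀, n₀ ≤ x^δ`)."  This file provides the algebraic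
part of this reduction for the tree's truncated frequency sum `ℛ₁^{≤H}` (hypothesis of
`Drappeau2017_theorem51_of_R1`) and carries it out:

* `Drappeau2017.sum_gcd_partition` — splitting a sum over `(q₁,q₂,n₁,n₂)` according to the values
  `q₀ = (q₁,q₂)`, `n₀ = (n₁,n₂)` (the weights `1_{(q₁,q₂)=q₀,(n₁,n₂)=n₀}` of
  `DrappeauDispersionS1PoissonWeighted`);
* `Drappeau2017.norm_R1piece_le` — for every `(q₀,n₀)`:
  `|ℛ₁^{wt,≤H}| ≤ |𝒮₁^{wt}| + A₀|X₁^{wt}| + (truncation error)`, from the weighted Poisson identity;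
  combined with `norm_S1piece_le`, `norm_X1piece_le`, `S1piece_eq_zero`, `X1piece_eq_zero`
  (`DrappeauDispersionS1Gcd`) this bounds the pieces with `max(q₀,n₀) > K` or bad `(q₀,n₀)`;
* `Drappeau2017.sum_sum_ite_max_inv_sq_le` — `∑_{max(q₀,n₀) > K} 1/(q₀²n₀²) ≤ 8/K`;
* `Drappeau2017.R1_of_R1small` — the reduction itself (`K = ⌊x^κ⌋`, `δ = min(δ₁, κ/4, η/8, 1/100)`):
  a bound `O(MN²x^{−3κ})` for the pieces with good `q₀, n₀ ≤ x^κ` gives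
  `|ℛ₁^{≤H}| ≤ C MN² (log x)⁴/R²`;
* `Drappeau2017_theorem51_of_R1small` — hence Theorem 5.1 from that bound (the remaining input is
  the paper's Theorem 2.1 via (5.23)–(5.24)).

## References

* S. Drappeau, Proc. London Math. Soc. (3) 114 (2017) 684–732, arXiv:1504.05549, §5.4.
  [cite: Drappeau2017, §5.4]
-/

noncomputable section

open Finset Real Complex MeasureTheory
open scoped FourierTransform ContDiff ArithmeticFunction.sigma

namespace Literature.NumberTheory.Sieve

namespace Drappeau2017

/-! ### Partition by the values of the gcd's -/

/-- `∑_{q₀ ≤ L_A} ∑_{n₀ ≤ L_B} 1_{(q₁,q₂)=q₀,(n₁,n₂)=n₀} = 1` for `q_j ∈ [1,L_A]`, `n_j ∈ [1,L_B]`.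
[folklore] -/
theorem sum_sum_ite_gcd_eq_one {LA LB q₁ q₂ n₁ n₂ : ℕ} (hq₁ : q₁ ∈ Icc 1 LA) (hn₁ : n₁ ∈ Icc 1 LB) :
    ∑ q₀ ∈ Icc 1 LA, ∑ n₀ ∈ Icc 1 LB,
      (if (Nat.gcd q₁ q₂ = q₀ ∧ Nat.gcd n₁ n₂ = n₀) then (1 : ℂ) else 0) = 1 := by
  have hq₁' := Finset.mem_Icc.1 hq₁
  have hn₁' := Finset.mem_Icc.1 hn₁
  have hg₁ : Nat.gcd q₁ q₂ ∈ Icc 1 LA := by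
    rw [Finset.mem_Icc]
    exact ⟨Nat.pos_of_ne_zero (Nat.gcd_ne_zero_left (by omega)),
      (Nat.gcd_le_left q₂ (by omega)).trans hq₁'.2⟩
  have hg₂ : Nat.gcd n₁ n₂ ∈ Icc 1 LB := by
    rw [Finset.mem_Icc]
    exact ⟨Nat.pos_of_ne_zero (Nat.gcd_ne_zero_left (by omega)),
      (Nat.gcd_le_left n₂ (by omega)).trans hn₁'.2⟩
  have h : ∀ q₀ n₀ : ℕ, (if (Nat.gcd q₁ q₂ = q₀ ∧ Nat.gcd n₁ n₂ = n₀) then (1 : ℂ) else 0) =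
      (if Nat.gcd q₁ q₂ = q₀ then (1 : ℂ) else 0) * (if Nat.gcd n₁ n₂ = n₀ then (1 : ℂ) else 0) := by
    intro q₀ n₀
    by_cases h1 : Nat.gcd q₁ q₂ = q₀ <;> by_cases h2 : Nat.gcd n₁ n₂ = n₀ <;> simp [h1, h2]
  simp_rw [h, ← Finset.mul_sum, ← Finset.sum_mul]
  rw [Finset.sum_ite_eq, if_pos hg₁, Finset.sum_ite_eq, if_pos hg₂, one_mul]

/-- **Partition of a sum over `(q₁,q₂,n₁,n₂)` by `q₀ = (q₁,q₂)`, `n₀ = (n₁,n₂)`**: for `A ⊆ [1,L_A]`,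
`B ⊆ [1,L_B]`,
`∑_{q₁,q₂∈A} c ∑_{n₁,n₂∈B} F = ∑_{q₀ ≤ L_A} ∑_{n₀ ≤ L_B} ∑_{q₁,q₂∈A} c ∑_{n₁,n₂∈B} 1_{(q₁,q₂)=q₀,(n₁,n₂)=n₀} F`
(the paper's `𝒮₁ = ∑_{q₀,n₀} 𝒮₁(q₀,n₀)`). [cite: Drappeau2017, §5.4] -/
theorem sum_gcd_partition (A B : Finset ℕ) {LA LB : ℕ} (hA : A ⊆ Icc 1 LA) (hB : B ⊆ Icc 1 LB)
    (c : ℕ → ℕ → ℂ) (F : ℕ → ℕ → ℕ → ℕ → ℂ) :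
    ∑ q₁ ∈ A, ∑ q₂ ∈ A, c q₁ q₂ * ∑ n₁ ∈ B, ∑ n₂ ∈ B, F q₁ q₂ n₁ n₂ =
      ∑ q₀ ∈ Icc 1 LA, ∑ n₀ ∈ Icc 1 LB, ∑ q₁ ∈ A, ∑ q₂ ∈ A, c q₁ q₂ * ∑ n₁ ∈ B, ∑ n₂ ∈ B,
        (if (Nat.gcd q₁ q₂ = q₀ ∧ Nat.gcd n₁ n₂ = n₀) then (1 : ℂ) else 0) * F q₁ q₂ n₁ n₂ := by
  symm
  rw [← Finset.sum_product']
  rw [Finset.sum_comm]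
  refine Finset.sum_congr rfl fun q₁ hq₁ => ?_
  rw [Finset.sum_comm]
  refine Finset.sum_congr rfl fun q₂ _ => ?_
  rw [← Finset.mul_sum]
  congr 1
  rw [Finset.sum_comm]
  refine Finset.sum_congr rfl fun n₁ hn₁ => ?_
  rw [Finset.sum_comm]
  refine Finset.sum_congr rfl fun n₂ _ => ?_
  rw [← Finset.sum_mul, Finset.sum_product]
  simp only [sum_sum_ite_gcd_eq_one (hA hq₁) (hB hn₁), one_mul]

/-! ### The piece `ℛ₁^{wt,≤H}` against `𝒮₁^{wt}` and `X₁^{wt}` -/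

/-- Bookkeeping: `T = A·X + F`, `|F − F'| ≤ t` ⇒ `|F'| ≤ |T| + A|X| + t` (`A ≥ 0`). [folklore] -/
theorem norm_le_of_identity_of_trunc {T X F F' : ℂ} {A : ℝ} (hA : 0 ≤ A) (hid : T = (A : ℂ) * X + F)
    {t : ℝ} (htr : ‖F - F'‖ ≤ t) : ‖F'‖ ≤ ‖T‖ + A * ‖X‖ + t := by
  have h1 : F' = (T - (A : ℂ) * X) - (F - F') := by rw [hid]; ring
  rw [h1]
  refine (norm_sub_le _ _).trans (add_le_add ((norm_sub_le _ _).trans (le_of_eq ?_)) htr)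
  rw [norm_mul, Complex.norm_real, Real.norm_eq_abs, abs_of_nonneg hA]

/-- **`|ℛ₁^{wt,≤H}| ≤ |𝒮₁^{wt}| + A₀|X₁^{wt}| + truncation error`** for any weight `|wt| ≤ 1`
(`α = BFI.bump M (M/2)`, `A₀ = ∑_m α(m)`, `H ≥ 1`, `n ≥ 2`; `sum_weighted_msum_eq` and
`norm_weighted_freq_sub_trunc_le`). [cite: Drappeau2017, §5.4–5.5] -/
theorem norm_R1piece_le (a₁ a₂ : ℤ) {𝒬 : Finset ℕ} (h𝒬 : ∀ q ∈ 𝒬, 0 < q)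
    (𝒩 : Finset ℕ) (γ : ℕ → ℝ) (β : ℕ → ℂ) {wt : ℕ → ℕ → ℕ → ℕ → ℂ}
    (hwt : ∀ q₁ q₂ n₁ n₂, ‖wt q₁ q₂ n₁ n₂‖ ≤ 1) {M : ℝ} (hM : 0 < M) {H : ℕ} (hH : 1 ≤ H) {n : ℕ}
    (hn : 2 ≤ n) :
    ‖∑ q₁ ∈ 𝒬.filter (fun q : ℕ => IsCoprime (q : ℤ) (a₁ * a₂)),
        ∑ q₂ ∈ 𝒬.filter (fun q : ℕ => IsCoprime (q : ℤ) (a₁ * a₂)), (γ q₁ : ℂ) * (γ q₂ : ℂ) *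
          ∑ n₁ ∈ 𝒩.filter (fun n : ℕ => IsCoprime (n : ℤ) a₂),
            ∑ n₂ ∈ 𝒩.filter (fun n : ℕ => IsCoprime (n : ℤ) a₂),
              wt q₁ q₂ n₁ n₂ * (β n₁ * starRingEnd ℂ (β n₂)) *
              ((M : ℂ) / (Nat.lcm q₁ q₂ : ℂ) *
                ∑ b ∈ (Finset.range (Nat.lcm q₁ q₂)).filter (fun b : ℕ =>
                    (b : ZMod q₁) * ((n₁ : ZMod q₁) * (a₂ : ZMod q₁)) = (a₁ : ZMod q₁) ∧
                    (b : ZMod q₂) * ((n₂ : ZMod q₂) * (a₂ : ZMod q₂)) = (a₁ : ZMod q₂)),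
                  ∑ h ∈ Finset.Icc (-(H : ℤ)) H, (if ((Nat.lcm q₁ q₂ : ℕ) : ℤ) ∣ h then 0 else
                    𝓕 (BFI.bumpC 1 (1 / 2)) (M * h / (Nat.lcm q₁ q₂ : ℕ)) *
                      (𝐞 ((b : ℝ) * h / (Nat.lcm q₁ q₂ : ℕ)) : ℂ)))‖ ≤
      ‖∑ q₁ ∈ 𝒬.filter (fun q : ℕ => IsCoprime (q : ℤ) (a₁ * a₂)),
          ∑ q₂ ∈ 𝒬.filter (fun q : ℕ => IsCoprime (q : ℤ) (a₁ * a₂)), (γ q₁ : ℂ) * (γ q₂ : ℂ) *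
            ∑ n₁ ∈ 𝒩.filter (fun n : ℕ => IsCoprime (n : ℤ) a₂),
              ∑ n₂ ∈ 𝒩.filter (fun n : ℕ => IsCoprime (n : ℤ) a₂),
                wt q₁ q₂ n₁ n₂ * (β n₁ * starRingEnd ℂ (β n₂)) *
                ∑ m ∈ BFI.mRange M (M / 2), ((BFI.bump M (M / 2) m : ℝ) : ℂ) *
                  (if kerArg a₁ a₂ q₁ m n₁ = 1 then 1 else 0) *
                    (if kerArg a₁ a₂ q₂ m n₂ = 1 then 1 else 0)‖ +
      (∑ m ∈ BFI.mRange M (M / 2), BFI.bump M (M / 2) m) *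
        ‖∑ q₁ ∈ 𝒬.filter (fun q : ℕ => IsCoprime (q : ℤ) (a₁ * a₂)),
            ∑ q₂ ∈ 𝒬.filter (fun q : ℕ => IsCoprime (q : ℤ) (a₁ * a₂)),
              ((γ q₁ * γ q₂ / (Nat.lcm q₁ q₂ : ℝ) : ℝ) : ℂ) *
                ∑ n₁ ∈ (𝒩.filter (fun n : ℕ => IsCoprime (n : ℤ) a₂)).filter (fun n => n.Coprime q₁),
                  ∑ n₂ ∈ (𝒩.filter (fun n : ℕ => IsCoprime (n : ℤ) a₂)).filter (fun n => n.Coprime q₂),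
                    (if (n₁ : ZMod (Nat.gcd q₁ q₂)) = (n₂ : ZMod (Nat.gcd q₁ q₂)) then
                      wt q₁ q₂ n₁ n₂ * (β n₁ * starRingEnd ℂ (β n₂)) else 0)‖ +
      ∑ q₁ ∈ 𝒬.filter (fun q : ℕ => IsCoprime (q : ℤ) (a₁ * a₂)),
        ∑ q₂ ∈ 𝒬.filter (fun q : ℕ => IsCoprime (q : ℤ) (a₁ * a₂)), |γ q₁ * γ q₂| *
          ((∑ n ∈ 𝒩.filter (fun n : ℕ => IsCoprime (n : ℤ) a₂), ‖β n‖) ^ 2 *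
            (M / (Nat.lcm q₁ q₂ : ℝ) * (2 * (∫ t, ‖iteratedDeriv n (BFI.bumpC 1 (1 / 2)) t‖) *
              ((Nat.lcm q₁ q₂ : ℝ) / (2 * π * M)) ^ n * (((H : ℝ) ^ (n - 1)))⁻¹))) := by
  have hid := sum_weighted_msum_eq a₁ a₂ h𝒬 𝒩 γ β wt hM
  have htr := norm_weighted_freq_sub_trunc_le a₁ a₂ h𝒬 𝒩 γ β hwt hM hH hn
  have hM2 : (0 : ℝ) < M / 2 := by linarith
  have hA0 : 0 ≤ ∑ m ∈ BFI.mRange M (M / 2), BFI.bump M (M / 2) m :=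
    Finset.sum_nonneg fun m _ => (BFI.bump_mem_Icc hM2 hM.le _).1
  exact norm_le_of_identity_of_trunc hA0 hid htr

/-! ### Sums over `(q₀, n₀)` -/

/-- `∑_{K < q ≤ X} 1/q² ≤ 2/K` for `K > 0`. [folklore] -/
theorem sum_Icc_filter_inv_sq_le (X : ℕ) {K : ℝ} (hK : 0 < K) :
    ∑ q ∈ (Icc 1 X).filter (fun q : ℕ => K < (q : ℝ)), (((q : ℝ)) ^ 2)⁻¹ ≤ 2 / K := by
  have h := PowerfulPart.sum_inv_sq_filter_le X Nat.one_pos (K := K ^ 2) (by positivity)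
  have hfilt : (Icc 1 X).filter (fun c : ℕ => K ^ 2 < (c : ℝ) ^ 2 * ((1 : ℕ) : ℝ) ^ 3) =
      (Icc 1 X).filter (fun q : ℕ => K < (q : ℝ)) := by
    refine Finset.filter_congr fun q _ => ?_
    rw [Nat.cast_one, one_pow, mul_one]
    exact pow_lt_pow_iff_left₀ hK.le (Nat.cast_nonneg _) two_ne_zero
  rw [hfilt, Nat.cast_one, Real.sqrt_one, mul_one, mul_one, Real.sqrt_sq hK.le] at h
  exact h

/-- `∑_{q₀ ≤ X, n₀ ≤ X', max(q₀,n₀) > K} 1/(q₀²n₀²) ≤ 8/K` for `K > 0`. [folklore] -/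
theorem sum_sum_ite_max_inv_sq_le (X X' : ℕ) {K : ℝ} (hK : 0 < K) :
    ∑ q₀ ∈ Icc 1 X, ∑ n₀ ∈ Icc 1 X', (if K < max (q₀ : ℝ) (n₀ : ℝ) then
        (((q₀ : ℝ)) ^ 2)⁻¹ * (((n₀ : ℝ)) ^ 2)⁻¹ else 0) ≤ 8 / K := by
  have hq := sum_Icc_filter_inv_sq_le X hK
  have hn := sum_Icc_filter_inv_sq_le X' hK
  have hq2 := Polymath8a.sum_Icc_inv_pow_le_two le_rfl X
  have hn2 := Polymath8a.sum_Icc_inv_pow_le_two le_rfl X'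
  rw [Finset.sum_filter] at hq hn
  -- `1_{max > K} ≤ 1_{q₀ > K} + 1_{n₀ > K}`
  have hle : ∀ q₀ n₀ : ℕ, (if K < max (q₀ : ℝ) (n₀ : ℝ) then
      (((q₀ : ℝ)) ^ 2)⁻¹ * (((n₀ : ℝ)) ^ 2)⁻¹ else 0) ≤
      (if K < (q₀ : ℝ) then (((q₀ : ℝ)) ^ 2)⁻¹ else 0) * (((n₀ : ℝ)) ^ 2)⁻¹ +
        (((q₀ : ℝ)) ^ 2)⁻¹ * (if K < (n₀ : ℝ) then (((n₀ : ℝ)) ^ 2)⁻¹ else 0) := by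
    intro q₀ n₀
    by_cases h : K < max (q₀ : ℝ) (n₀ : ℝ)
    · rw [if_pos h]
      rcases lt_max_iff.1 h with h1 | h1
      · rw [if_pos h1]
        have : 0 ≤ (((q₀ : ℝ)) ^ 2)⁻¹ * (if K < (n₀ : ℝ) then (((n₀ : ℝ)) ^ 2)⁻¹ else 0) := by
          positivity
        linarith
      · rw [if_pos h1]
        have : 0 ≤ (if K < (q₀ : ℝ) then (((q₀ : ℝ)) ^ 2)⁻¹ else 0) * (((n₀ : ℝ)) ^ 2)⁻¹ := by
          positivity
        linarith
    · rw [if_neg h]; positivity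
  calc _ ≤ ∑ q₀ ∈ Icc 1 X, ∑ n₀ ∈ Icc 1 X',
        ((if K < (q₀ : ℝ) then (((q₀ : ℝ)) ^ 2)⁻¹ else 0) * (((n₀ : ℝ)) ^ 2)⁻¹ +
          (((q₀ : ℝ)) ^ 2)⁻¹ * (if K < (n₀ : ℝ) then (((n₀ : ℝ)) ^ 2)⁻¹ else 0)) :=
        Finset.sum_le_sum fun q₀ _ => Finset.sum_le_sum fun n₀ _ => hle q₀ n₀
    _ = (∑ q₀ ∈ Icc 1 X, (if K < (q₀ : ℝ) then (((q₀ : ℝ)) ^ 2)⁻¹ else 0)) *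
          (∑ n₀ ∈ Icc 1 X', (((n₀ : ℝ)) ^ 2)⁻¹) +
        (∑ q₀ ∈ Icc 1 X, (((q₀ : ℝ)) ^ 2)⁻¹) *
          ∑ n₀ ∈ Icc 1 X', (if K < (n₀ : ℝ) then (((n₀ : ℝ)) ^ 2)⁻¹ else 0) := by
        rw [Finset.sum_mul_sum, Finset.sum_mul_sum, ← Finset.sum_add_distrib]
        refine Finset.sum_congr rfl fun q₀ _ => ?_
        rw [← Finset.sum_add_distrib]
    _ ≤ (2 / K) * 2 + 2 * (2 / K) := by
        have h0 : 0 ≤ ∑ n₀ ∈ Icc 1 X', (((n₀ : ℝ)) ^ 2)⁻¹ := Finset.sum_nonneg fun _ _ => by positivity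
        have h0' : 0 ≤ ∑ n₀ ∈ Icc 1 X', (if K < (n₀ : ℝ) then (((n₀ : ℝ)) ^ 2)⁻¹ else 0) :=
          Finset.sum_nonneg fun _ _ => by positivity
        exact add_le_add (mul_le_mul hq hn2 h0 (by positivity)) (mul_le_mul hq2 hn h0' (by norm_num))
    _ = 8 / K := by ring

/-! ### Bookkeeping lemmas -/

/-- Bookkeeping for the trivial bounds of the two pieces (pure real arithmetic). [folklore] -/
theorem trivial_pieces_alg {T AX τM B P Sq X' L' L₀' A₀ M N L q₀ n₀ : ℝ}
    (hT : T ≤ τM * B ^ 2 * Sq * P) (hSq : Sq ≤ (X' * L' + L₀') / q₀)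
    (hAX : AX ≤ A₀ * (B ^ 2 * (L' ^ 2 / q₀) * P))
    (hP : P ≤ (2 * N / n₀ + 1) * (2 * N / (n₀ * q₀) + 1)) (hP0 : 0 ≤ P)
    (hX' : X' ≤ 5 * M / 2) (hX'0 : 0 ≤ X') (hL₀ : L₀' ≤ 3 * M)
    (hA₀ : A₀ ≤ 7 * M / 2) (hL'0 : 0 ≤ L') (hL'L : L' ≤ 3 * L) (hL1 : 1 ≤ L)
    (hτ : 0 ≤ τM) (hq₀ : 1 ≤ q₀) (hn₀ : 1 ≤ n₀) (hN : 0 ≤ N) (hM : 0 ≤ M) :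
    T + AX ≤ 32 * (τM + 1) * B ^ 2 * M * L ^ 2 *
      (4 * N ^ 2 * (q₀ ^ 2)⁻¹ * (n₀ ^ 2)⁻¹ + 4 * N * q₀⁻¹ * n₀⁻¹ + q₀⁻¹) := by
  have hq₀0 : 0 < q₀ := by linarith
  have hn₀0 : 0 < n₀ := by linarith
  -- `P/q₀`
  have hPq : P / q₀ ≤ 4 * N ^ 2 * (q₀ ^ 2)⁻¹ * (n₀ ^ 2)⁻¹ + 4 * N * q₀⁻¹ * n₀⁻¹ + q₀⁻¹ := by
    have h1 : P / q₀ ≤ (2 * N / n₀ + 1) * (2 * N / (n₀ * q₀) + 1) / q₀ :=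
      div_le_div_of_nonneg_right hP hq₀0.le
    refine h1.trans ?_
    have h2 : (2 * N / n₀ + 1) * (2 * N / (n₀ * q₀) + 1) / q₀ =
        4 * N ^ 2 * (q₀ ^ 2)⁻¹ * (n₀ ^ 2)⁻¹ + 2 * N * q₀⁻¹ * n₀⁻¹ +
          2 * N * (q₀ ^ 2)⁻¹ * n₀⁻¹ + q₀⁻¹ := by
      field_simp
      ring
    rw [h2]
    have h3 : 2 * N * (q₀ ^ 2)⁻¹ * n₀⁻¹ ≤ 2 * N * q₀⁻¹ * n₀⁻¹ := by
      have hqq : (q₀ ^ 2)⁻¹ ≤ q₀⁻¹ := by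
        rw [inv_le_inv₀ (by positivity) hq₀0]; nlinarith
      have h0 : 0 ≤ 2 * N * n₀⁻¹ := by positivity
      calc 2 * N * (q₀ ^ 2)⁻¹ * n₀⁻¹ = 2 * N * n₀⁻¹ * (q₀ ^ 2)⁻¹ := by ring
        _ ≤ 2 * N * n₀⁻¹ * q₀⁻¹ := mul_le_mul_of_nonneg_left hqq h0
        _ = _ := by ring
    linarith
  have hPq0 : 0 ≤ P / q₀ := div_nonneg hP0 hq₀0.le
  -- `T`
  have hL2 : L ≤ L ^ 2 := by nlinarith
  have hXL : X' * L' + L₀' ≤ 21 / 2 * M * L ^ 2 := by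
    have h1 : X' * L' ≤ (5 * M / 2) * (3 * L) := mul_le_mul hX' hL'L hL'0 (by linarith)
    nlinarith
  have hB0 : 0 ≤ B ^ 2 := sq_nonneg _
  have hT' : T ≤ τM * B ^ 2 * (21 / 2 * M * L ^ 2) * (P / q₀) := by
    calc T ≤ τM * B ^ 2 * Sq * P := hT
      _ = (τM * B ^ 2 * P) * Sq := by ring
      _ ≤ (τM * B ^ 2 * P) * ((X' * L' + L₀') / q₀) :=
          mul_le_mul_of_nonneg_left hSq (by positivity)
      _ = τM * B ^ 2 * (X' * L' + L₀') * (P / q₀) := by ring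
      _ ≤ τM * B ^ 2 * (21 / 2 * M * L ^ 2) * (P / q₀) := by
          refine mul_le_mul_of_nonneg_right ?_ hPq0
          exact mul_le_mul_of_nonneg_left hXL (by positivity)
  -- `A₀ X`
  have hAX' : AX ≤ 63 / 2 * M * L ^ 2 * B ^ 2 * (P / q₀) := by
    have hL'2 : L' ^ 2 ≤ 9 * L ^ 2 := by nlinarith
    have h1 : A₀ * L' ^ 2 ≤ (7 * M / 2) * (9 * L ^ 2) := mul_le_mul hA₀ hL'2 (sq_nonneg _) (by linarith)
    calc AX ≤ A₀ * (B ^ 2 * (L' ^ 2 / q₀) * P) := hAX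
      _ = (A₀ * L' ^ 2) * (B ^ 2 * (P / q₀)) := by ring
      _ ≤ ((7 * M / 2) * (9 * L ^ 2)) * (B ^ 2 * (P / q₀)) :=
          mul_le_mul_of_nonneg_right h1 (by positivity)
      _ = _ := by ring
  -- together
  have hsum : T + AX ≤ 32 * (τM + 1) * B ^ 2 * M * L ^ 2 * (P / q₀) := by
    have h0 : 0 ≤ B ^ 2 * M * L ^ 2 * (P / q₀) := by positivity
    have e : τM * B ^ 2 * (21 / 2 * M * L ^ 2) * (P / q₀) + 63 / 2 * M * L ^ 2 * B ^ 2 * (P / q₀) =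
        (21 / 2 * τM + 63 / 2) * (B ^ 2 * M * L ^ 2 * (P / q₀)) := by ring
    have h1 : (21 / 2 * τM + 63 / 2) * (B ^ 2 * M * L ^ 2 * (P / q₀)) ≤
        (32 * (τM + 1)) * (B ^ 2 * M * L ^ 2 * (P / q₀)) :=
      mul_le_mul_of_nonneg_right (by linarith) h0
    calc T + AX ≤ (21 / 2 * τM + 63 / 2) * (B ^ 2 * M * L ^ 2 * (P / q₀)) := by
          rw [← e]; exact add_le_add hT' hAX'
      _ ≤ (32 * (τM + 1)) * (B ^ 2 * M * L ^ 2 * (P / q₀)) := h1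
      _ = 32 * (τM + 1) * B ^ 2 * M * L ^ 2 * (P / q₀) := by ring
  refine hsum.trans (mul_le_mul_of_nonneg_left hPq ?_)
  positivity

/-- `∑_{n ≤ X} 1_{n ≤ K} c ≤ c K` (`c ≥ 0`). [folklore] -/
theorem sum_Icc_ite_le_le (X K : ℕ) {c : ℝ} (hc : 0 ≤ c) :
    ∑ n ∈ Icc 1 X, (if n ≤ K then c else 0) ≤ c * K := by
  rw [← Finset.sum_filter, Finset.sum_const, nsmul_eq_mul]
  have h : ((Icc 1 X).filter (fun n => n ≤ K)).card ≤ K := by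
    calc ((Icc 1 X).filter (fun n => n ≤ K)).card ≤ (Icc 1 K).card := by
          refine Finset.card_le_card fun n hn => ?_
          rw [Finset.mem_filter, Finset.mem_Icc] at hn
          rw [Finset.mem_Icc]; exact ⟨hn.1.1, hn.2⟩
      _ = K := by simp
  calc (((Icc 1 X).filter (fun n => n ≤ K)).card : ℝ) * c ≤ (K : ℝ) * c :=
        mul_le_mul_of_nonneg_right (by exact_mod_cast h) hc
    _ = c * K := mul_comm _ _

/-- `∑_{q₀ ≤ X} ∑_{n₀ ≤ X'} (4N/(q₀n₀) + 1/q₀) ≤ (1 + log X)(4N(1 + log X') + X')` (`N ≥ 0`).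
[folklore] -/
theorem sum_sum_inv_add_le (X X' : ℕ) {N : ℝ} (hN : 0 ≤ N) :
    ∑ q₀ ∈ Icc 1 X, ∑ n₀ ∈ Icc 1 X', (4 * N * ((q₀ : ℝ))⁻¹ * ((n₀ : ℝ))⁻¹ + ((q₀ : ℝ))⁻¹) ≤
      (1 + Real.log X) * (4 * N * (1 + Real.log X') + X') := by
  have hq := harmonic_Icc_le X
  have hn := harmonic_Icc_le X'
  have hn0 : 0 ≤ ∑ n₀ ∈ Icc 1 X', ((n₀ : ℝ))⁻¹ := Finset.sum_nonneg fun _ _ => by positivity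
  have e : ∀ q₀ : ℕ, ∑ n₀ ∈ Icc 1 X', (4 * N * ((q₀ : ℝ))⁻¹ * ((n₀ : ℝ))⁻¹ + ((q₀ : ℝ))⁻¹) =
      ((q₀ : ℝ))⁻¹ * (4 * N * ∑ n₀ ∈ Icc 1 X', ((n₀ : ℝ))⁻¹ + X') := by
    intro q₀
    rw [Finset.sum_add_distrib, Finset.sum_const, Nat.card_Icc, nsmul_eq_mul, Finset.mul_sum,
      mul_add, Finset.mul_sum]
    simp only [Nat.add_sub_cancel]
    congr 1
    · exact Finset.sum_congr rfl fun _ _ => by ring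
    · ring
  simp_rw [e]
  rw [← Finset.sum_mul]
  have h1 : 4 * N * ∑ n₀ ∈ Icc 1 X', ((n₀ : ℝ))⁻¹ + X' ≤ 4 * N * (1 + Real.log X') + X' := by
    have := mul_le_mul_of_nonneg_left hn (show 0 ≤ 4 * N by positivity); linarith
  have h0 : 0 ≤ 4 * N * ∑ n₀ ∈ Icc 1 X', ((n₀ : ℝ))⁻¹ + X' := by positivity
  have hq0 : 0 ≤ 1 + Real.log X := by have := Real.log_natCast_nonneg X; linarith
  exact mul_le_mul hq h1 h0 hq0

/-- Product version of `sum_gcd_partition` (summand `P(n₁,n₂) G(q₁,q₂,n₁,n₂)`).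
[cite: Drappeau2017, §5.4] -/
theorem sum_gcd_partition' (A B : Finset ℕ) {LA LB : ℕ} (hA : A ⊆ Icc 1 LA) (hB : B ⊆ Icc 1 LB)
    (c : ℕ → ℕ → ℂ) (P : ℕ → ℕ → ℂ) (G : ℕ → ℕ → ℕ → ℕ → ℂ) :
    ∑ q₁ ∈ A, ∑ q₂ ∈ A, c q₁ q₂ * ∑ n₁ ∈ B, ∑ n₂ ∈ B, P n₁ n₂ * G q₁ q₂ n₁ n₂ =
      ∑ q₀ ∈ Icc 1 LA, ∑ n₀ ∈ Icc 1 LB, ∑ q₁ ∈ A, ∑ q₂ ∈ A, c q₁ q₂ * ∑ n₁ ∈ B, ∑ n₂ ∈ B,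
        (if (Nat.gcd q₁ q₂ = q₀ ∧ Nat.gcd n₁ n₂ = n₀) then (1 : ℂ) else 0) * P n₁ n₂ *
          G q₁ q₂ n₁ n₂ := by
  rw [sum_gcd_partition A B hA hB c (fun q₁ q₂ n₁ n₂ => P n₁ n₂ * G q₁ q₂ n₁ n₂)]
  refine Finset.sum_congr rfl fun q₀ _ => Finset.sum_congr rfl fun n₀ _ =>
    Finset.sum_congr rfl fun q₁ _ => Finset.sum_congr rfl fun q₂ _ => ?_
  congr 1
  refine Finset.sum_congr rfl fun n₁ _ => Finset.sum_congr rfl fun n₂ _ => ?_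
  ring

/-! ### The reduction -/

set_option maxHeartbeats 1600000 in
/-- **Drappeau 2017, §5.4: `ℛ₁^{≤H}` from the pieces `ℛ₁(q₀,n₀)` with small good `(q₀,n₀)`**
(core, `ε₁, κ, η` fixed).  If, for the given `ε₁, κ, η > 0`, the pieces `ℛ₁^{wt,≤H}(q₀,n₀)` (weight `1_{(q₁,q₂)=q₀,(n₁,n₂)=n₀}`,
`H = ⌈(3S)²x^{ε₁}/M⌉`) with `q₀, n₀ ≤ x^κ`, `(q₀,n₀) = (q₀,a₁a₂) = (n₀,a₂) = 1` are
`O(MN²x^{−3κ})` in the range of Theorem 5.1, then `|ℛ₁^{≤H}| ≤ C M N² (log x)⁴/R²` there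
(hypothesis of `Drappeau2017_theorem51_of_R1`): the pieces with `max(q₀,n₀) > K = ⌊x^κ⌋` are
handled by the trivial bounds `norm_S1piece_le`, `norm_X1piece_le` and the counting lemma
`card_pairs_le` ("`∑_{max{q₀,n₀}>K} |𝒮₁(q₀,n₀)| ≪ x^ε MN²K^{−1}`", and the same for the main
terms), the pieces with bad `(q₀,n₀)` vanish (`S1piece_eq_zero`, `X1piece_eq_zero`).
[cite: Drappeau2017, §5.4] -/
theorem R1_of_R1small_core {ε₁ κ η : ℝ} (hε₁ : 0 < ε₁) (hκ : 0 < κ) (hη : 0 < η)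
    (HR : ∃ δ : ℝ, 0 < δ ∧ ∀ Aτ : ℝ, 0 ≤ Aτ →
      ∃ C x₀ : ℝ, ∀ x : ℝ, x₀ ≤ x →
      ∀ M N S Rd Y : ℝ, M * N = x → x ^ η ≤ N → N ≤ S ^ (2 / 3 - η) → x ^ (1 / 4 : ℝ) ≤ S →
        S ≤ x ^ (1 / 2 + δ) → 1 ≤ Rd → Rd ≤ x ^ δ → S * x ^ (-δ) ≤ Y → Y ≤ S / 4 →
      ∀ a₁ a₂ : ℤ, a₁ ≠ 0 → a₂ ≠ 0 → (|a₁| : ℝ) ≤ x ^ δ → (|a₂| : ℝ) ≤ x ^ δ →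
      ∀ β : ℕ → ℂ, (∀ n, ‖β n‖ ≤ (σ 0 n : ℝ) ^ Aτ) → (∀ n, ¬Squarefree n → β n = 0) →
      ∀ q₀ n₀ : ℕ, 0 < q₀ → (q₀ : ℝ) ≤ x ^ κ → 0 < n₀ → (n₀ : ℝ) ≤ x ^ κ → Nat.Coprime q₀ n₀ →
        IsCoprime (q₀ : ℤ) (a₁ * a₂) → IsCoprime (n₀ : ℤ) a₂ →
        ‖∑ q₁ ∈ ((BFI.mRange S Y).filter (fun q : ℕ => 0 < q)).filter
              (fun q : ℕ => IsCoprime (q : ℤ) (a₁ * a₂)),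
          ∑ q₂ ∈ ((BFI.mRange S Y).filter (fun q : ℕ => 0 < q)).filter
              (fun q : ℕ => IsCoprime (q : ℤ) (a₁ * a₂)),
            ((BFI.bump S Y q₁ : ℝ) : ℂ) * ((BFI.bump S Y q₂ : ℝ) : ℂ) *
            ∑ n₁ ∈ (BFI.dyadic N).filter (fun n : ℕ => IsCoprime (n : ℤ) a₂),
              ∑ n₂ ∈ (BFI.dyadic N).filter (fun n : ℕ => IsCoprime (n : ℤ) a₂),
                (if (Nat.gcd q₁ q₂ = q₀ ∧ Nat.gcd n₁ n₂ = n₀) then (1 : ℂ) else 0) *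
                  (β n₁ * starRingEnd ℂ (β n₂)) *
                ((M : ℂ) / (Nat.lcm q₁ q₂ : ℂ) *
                  ∑ b ∈ (Finset.range (Nat.lcm q₁ q₂)).filter (fun b : ℕ =>
                      (b : ZMod q₁) * ((n₁ : ZMod q₁) * (a₂ : ZMod q₁)) = (a₁ : ZMod q₁) ∧
                      (b : ZMod q₂) * ((n₂ : ZMod q₂) * (a₂ : ZMod q₂)) = (a₁ : ZMod q₂)),
                    ∑ h ∈ Finset.Icc (-(⌈(3 * S) ^ 2 * x ^ ε₁ / M⌉₊ : ℤ)) ⌈(3 * S) ^ 2 * x ^ ε₁ / M⌉₊,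
                      (if ((Nat.lcm q₁ q₂ : ℕ) : ℤ) ∣ h then 0 else
                        𝓕 (BFI.bumpC 1 (1 / 2)) (M * h / (Nat.lcm q₁ q₂ : ℕ)) *
                          (𝐞 ((b : ℝ) * h / (Nat.lcm q₁ q₂ : ℕ)) : ℂ)))‖ ≤
          C * M * N ^ 2 * x ^ (-3 * κ)) :
    ∃ δ : ℝ, 0 < δ ∧ ∀ Aτ : ℝ, 0 ≤ Aτ →
      ∃ C c₀ x₀ : ℝ, ∀ x : ℝ, x₀ ≤ x →
      ∀ M N S Rd Y : ℝ, M * N = x → x ^ η ≤ N → N ≤ S ^ (2 / 3 - η) → x ^ (1 / 4 : ℝ) ≤ S →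
        S ≤ x ^ (1 / 2 + δ) → 1 ≤ Rd → Rd ≤ x ^ δ → S * x ^ (-δ) ≤ Y → Y ≤ S / 4 →
      ∀ a₁ a₂ : ℤ, a₁ ≠ 0 → a₂ ≠ 0 → (|a₁| : ℝ) ≤ x ^ δ → (|a₂| : ℝ) ≤ x ^ δ →
      ∀ β : ℕ → ℂ, (∀ n, ‖β n‖ ≤ (σ 0 n : ℝ) ^ Aτ) → (∀ n, ¬Squarefree n → β n = 0) →
        ‖∑ q₁ ∈ ((BFI.mRange S Y).filter (fun q : ℕ => 0 < q)).filter
              (fun q : ℕ => IsCoprime (q : ℤ) (a₁ * a₂)),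
          ∑ q₂ ∈ ((BFI.mRange S Y).filter (fun q : ℕ => 0 < q)).filter
              (fun q : ℕ => IsCoprime (q : ℤ) (a₁ * a₂)),
            ((BFI.bump S Y q₁ : ℝ) : ℂ) * ((BFI.bump S Y q₂ : ℝ) : ℂ) *
            ∑ n₁ ∈ (BFI.dyadic N).filter (fun n : ℕ => IsCoprime (n : ℤ) a₂),
              ∑ n₂ ∈ (BFI.dyadic N).filter (fun n : ℕ => IsCoprime (n : ℤ) a₂),
                β n₁ * starRingEnd ℂ (β n₂) *
                ((M : ℂ) / (Nat.lcm q₁ q₂ : ℂ) *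
                  ∑ b ∈ (Finset.range (Nat.lcm q₁ q₂)).filter (fun b : ℕ =>
                      (b : ZMod q₁) * ((n₁ : ZMod q₁) * (a₂ : ZMod q₁)) = (a₁ : ZMod q₁) ∧
                      (b : ZMod q₂) * ((n₂ : ZMod q₂) * (a₂ : ZMod q₂)) = (a₁ : ZMod q₂)),
                    ∑ h ∈ Finset.Icc (-(⌈(3 * S) ^ 2 * x ^ ε₁ / M⌉₊ : ℤ)) ⌈(3 * S) ^ 2 * x ^ ε₁ / M⌉₊,
                      (if ((Nat.lcm q₁ q₂ : ℕ) : ℤ) ∣ h then 0 else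
                        𝓕 (BFI.bumpC 1 (1 / 2)) (M * h / (Nat.lcm q₁ q₂ : ℕ)) *
                          (𝐞 ((b : ℝ) * h / (Nat.lcm q₁ q₂ : ℕ)) : ℂ)))‖ ≤
          C * M * N ^ 2 * Real.log x ^ c₀ / Rd ^ 2 := by
  obtain ⟨δ₁, hδ₁, Hδ⟩ := HR
  set δ : ℝ := min δ₁ (min (κ / 4) (min (η / 8) (1 / 100))) with hδdef
  have hδ0 : 0 < δ := lt_min hδ₁ (lt_min (by positivity) (lt_min (by positivity) (by norm_num)))
  have hδ₁' : δ ≤ δ₁ := min_le_left _ _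
  have hδκ : δ ≤ κ / 4 := (min_le_right _ _).trans (min_le_left _ _)
  have hδη : δ ≤ η / 8 := (min_le_right _ _).trans ((min_le_right _ _).trans (min_le_left _ _))
  have hδ1 : δ ≤ 1 / 100 := (min_le_right _ _).trans ((min_le_right _ _).trans (min_le_right _ _))
  refine ⟨δ, hδ0, fun Aτ hAτ => ?_⟩
  obtain ⟨C₁, x₁, HC1⟩ := Hδ Aτ hAτ
  -- ### constants
  -- integrations by parts: `ε₁ (nI - 1) ≥ 6`
  obtain ⟨nI, hnI2, hnIε⟩ : ∃ n : ℕ, 2 ≤ n ∧ 6 ≤ ε₁ * ((n : ℝ) - 1) := by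
    refine ⟨⌈6 / ε₁⌉₊ + 2, by omega, ?_⟩
    have h1 : 6 / ε₁ ≤ ⌈6 / ε₁⌉₊ := Nat.le_ceil _
    have h2 : ((⌈6 / ε₁⌉₊ + 2 : ℕ) : ℝ) - 1 = (⌈6 / ε₁⌉₊ : ℝ) + 1 := by push_cast; ring
    rw [h2]
    have h3 : 6 = ε₁ * (6 / ε₁) := by field_simp
    nlinarith
  have hKd0 : 0 ≤ BFI.derivConst nI := zero_le_one.trans (BFI.one_le_derivConst nI)
  set In : ℝ := ∫ t, ‖iteratedDeriv nI (BFI.bumpC 1 (1 / 2)) t‖ with hIndef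
  have hIn0 : 0 ≤ In := integral_nonneg fun _ => norm_nonneg _
  have hInle : In ≤ 2 ^ (nI + 1) * BFI.derivConst nI :=
    integral_norm_iteratedDeriv_bumpC_one_half_le (by omega)
  -- divisor moments (for the truncation error)
  set r : ℕ := ⌈2 * Aτ⌉₊ with hrdef
  have hr : 2 * Aτ ≤ r := Nat.le_ceil _
  have hrA : Aτ ≤ r := by linarith
  obtain ⟨Cd, hCd, hCdle⟩ := exists_sum_sigma_zero_pow_le_real r
  set cd : ℕ := 2 ^ (r + 1) with hcddef
  set CB : ℝ := Cd * 2 ^ (cd + 1) with hCBdef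
  have hCB0 : 0 < CB := by positivity
  -- pointwise divisor bounds
  set ε : ℝ := min κ η / 70 with hεdef
  have hε0 : 0 < ε := div_pos (lt_min hκ hη) (by norm_num)
  have hεκ : 70 * ε ≤ κ := by rw [hεdef]; have := min_le_left κ η; linarith
  have hεη : 70 * ε ≤ η := by rw [hεdef]; have := min_le_right κ η; linarith
  obtain ⟨Cτ, hCτ1, hCτ⟩ := exists_sigma_zero_le_mul_rpow hε0
  set ε' : ℝ := ε / (Aτ + 1) with hε'def
  have hε'0 : 0 < ε' := by positivity
  have hε'A : 2 * ε' * Aτ ≤ 2 * ε := by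
    have h1 : ε' * (Aτ + 1) = ε := by rw [hε'def]; field_simp
    nlinarith [hε'0.le, hAτ]
  obtain ⟨Cβ, hCβ1, hCβ⟩ := exists_sigma_zero_le_mul_rpow hε'0
  have hCβA : 1 ≤ Cβ ^ Aτ := Real.one_le_rpow hCβ1 hAτ
  set CQ : ℝ := 64 * Cτ * (Cβ ^ Aτ) ^ 2 with hCQdef
  have hCQ0 : 0 < CQ := by positivity
  -- thresholds
  obtain ⟨x₂, hx₂⟩ := exists_mul_log_pow_le_rpow (108 * CB ^ 2 * (2 ^ (nI + 1) * BFI.derivConst nI))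
    (2 * cd) (κ := 1 / 2) (by norm_num)
  obtain ⟨x₃, hx₃⟩ := exists_mul_log_pow_le_rpow (64 * CQ) 0 (κ := 2 * κ / 5) (by positivity)
  obtain ⟨x₄, hx₄⟩ := exists_mul_log_pow_le_rpow (42 * CQ) 0 (κ := η / 2) (by positivity)
  obtain ⟨x₅, hx₅⟩ := exists_mul_log_pow_le_rpow 2 0 (κ := κ) hκ
  refine ⟨max C₁ 0 + 3, 4, max (max (max x₁ 9) (max x₂ x₃)) (max x₄ x₅), fun x hx M N S Rd Y hMN hN
    hNS hS hSx hRd1 hRd hY1 hY4 a₁ a₂ ha₁ ha₂ ha₁x ha₂x β hβ hβs => ?_⟩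
  -- ### sizes
  have hxx₁ : x₁ ≤ x :=
    le_trans (le_trans (le_trans (le_max_left _ _) (le_max_left _ _)) (le_max_left _ _)) hx
  have hx9 : 9 ≤ x :=
    le_trans (le_trans (le_trans (le_max_right _ _) (le_max_left _ _)) (le_max_left _ _)) hx
  have hxx₂ : x₂ ≤ x :=
    le_trans (le_trans (le_trans (le_max_left _ _) (le_max_right _ _)) (le_max_left _ _)) hx
  have hxx₃ : x₃ ≤ x :=
    le_trans (le_trans (le_trans (le_max_right _ _) (le_max_right _ _)) (le_max_left _ _)) hx
  have hxx₄ : x₄ ≤ x := le_trans (le_trans (le_max_left _ _) (le_max_right _ _)) hx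
  have hxx₅ : x₅ ≤ x := le_trans (le_trans (le_max_right _ _) (le_max_right _ _)) hx
  have hx1 : 1 ≤ x := by linarith
  have hx0 : 0 < x := by linarith
  set L : ℝ := Real.log x with hLdef
  have hL1 : 1 ≤ L := by
    rw [hLdef, Real.le_log_iff_exp_le (by linarith)]
    have := Real.exp_one_lt_d9
    linarith
  have hL0 : 0 < L := by linarith
  have hlog3 : Real.log 3 ≤ L := Real.log_le_log (by norm_num) (by linarith)
  have hlog2x : ∀ y : ℝ, 0 < y → y ≤ 3 * x → Real.log y ≤ 2 * L := by
    intro y hy hyx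
    calc Real.log y ≤ Real.log (3 * x) := Real.log_le_log hy hyx
      _ = Real.log 3 + Real.log x := Real.log_mul (by norm_num) hx0.ne'
      _ ≤ 2 * L := by rw [hLdef] at hlog3 ⊢; linarith
  have hlogle : ∀ y : ℝ, 0 ≤ y → y ≤ 3 * x → Real.log y ≤ 2 * L := by
    intro y hy0 hyx
    rcases hy0.eq_or_lt with h | h
    · rw [← h, Real.log_zero]; linarith
    · exact hlog2x y h hyx
  have hN0 : 0 < N := lt_of_lt_of_le (Real.rpow_pos_of_pos hx0 η) hN
  have hM0 : 0 < M := by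
    by_contra h
    have : M * N ≤ 0 := mul_nonpos_of_nonpos_of_nonneg (not_lt.1 h) hN0.le
    linarith
  have hM2 : (0 : ℝ) < M / 2 := by linarith
  have hS0 : 0 < S := lt_of_lt_of_le (Real.rpow_pos_of_pos hx0 _) hS
  have hS1 : 1 ≤ S := le_trans (Real.one_le_rpow hx1 (by norm_num)) hS
  have hRd0 : 0 < Rd := by linarith
  have hY0 : 0 < Y := lt_of_lt_of_le (mul_pos hS0 (Real.rpow_pos_of_pos hx0 _)) hY1
  have hYS : Y ≤ S := by linarith
  have hmono : ∀ {u v : ℝ}, u ≤ v → x ^ u ≤ x ^ v := fun h => Real.rpow_le_rpow_of_exponent_le hx1 h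
  have hle1 : ∀ {u : ℝ}, u ≤ 1 → x ^ u ≤ x := fun h => (hmono h).trans_eq (Real.rpow_one x)
  have hN1 : 1 ≤ N := le_trans (Real.one_le_rpow hx1 hη.le) hN
  have hSx1 : S ≤ x := hSx.trans (hle1 (by linarith))
  have hNS23 : N ≤ S ^ (2 / 3 : ℝ) :=
    hNS.trans (Real.rpow_le_rpow_of_exponent_le hS1 (by linarith))
  have hNx34 : N ≤ x ^ (17 / 50 : ℝ) := by
    refine hNS23.trans ?_
    calc S ^ (2 / 3 : ℝ) ≤ (x ^ (1 / 2 + δ)) ^ (2 / 3 : ℝ) := Real.rpow_le_rpow hS0.le hSx (by norm_num)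
      _ = x ^ ((1 / 2 + δ) * (2 / 3)) := by rw [← Real.rpow_mul hx0.le]
      _ ≤ x ^ (17 / 50 : ℝ) := hmono (by linarith)
  have hNx : N ≤ x := hNx34.trans (hle1 (by norm_num))
  have hMeq : M = x / N := by field_simp; linarith
  have hMhalf : x ^ (1 / 2 : ℝ) ≤ M := by
    rw [hMeq, le_div_iff₀ hN0]
    calc x ^ (1 / 2 : ℝ) * N ≤ x ^ (1 / 2 : ℝ) * x ^ (17 / 50 : ℝ) :=
          mul_le_mul_of_nonneg_left hNx34 (by positivity)
      _ = x ^ (21 / 25 : ℝ) := by rw [← Real.rpow_add hx0]; norm_num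
      _ ≤ x := hle1 (by norm_num)
  have hMbig : x ^ (33 / 50 : ℝ) ≤ M := by
    rw [hMeq, le_div_iff₀ hN0]
    calc x ^ (33 / 50 : ℝ) * N ≤ x ^ (33 / 50 : ℝ) * x ^ (17 / 50 : ℝ) :=
          mul_le_mul_of_nonneg_left hNx34 (by positivity)
      _ = x := by rw [← Real.rpow_add hx0]; norm_num
  have hSM : S ≤ M := hSx.trans ((hmono (by linarith)).trans hMbig)
  have hM1 : 1 ≤ M := hS1.trans hSM
  have hMx : M ≤ x := by
    calc M = M * 1 := (mul_one M).symm
      _ ≤ M * N := mul_le_mul_of_nonneg_left hN1 hM0.le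
      _ = x := hMN
  have hRd2δ : Rd ^ 2 ≤ x ^ (2 * δ) := by
    calc Rd ^ 2 ≤ (x ^ δ) ^ 2 := pow_le_pow_left₀ hRd0.le hRd 2
      _ = x ^ (2 * δ) := by rw [← Real.rpow_natCast, ← Real.rpow_mul hx0.le]; ring_nf
  have hRd2 : Rd ^ 2 ≤ x ^ (1 / 50 : ℝ) := hRd2δ.trans (hmono (by linarith))
  have hx2half : (2 : ℝ) ≤ x ^ (1 / 2 : ℝ) := by
    have h : (4 : ℝ) ^ (1 / 2 : ℝ) ≤ x ^ (1 / 2 : ℝ) :=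
      Real.rpow_le_rpow (by norm_num) (by linarith) (by norm_num)
    have e : (4 : ℝ) ^ (1 / 2 : ℝ) = 2 := by
      rw [show (4 : ℝ) = 2 ^ (2 : ℝ) by norm_num, ← Real.rpow_mul (by norm_num)]; norm_num
    linarith
  -- ### the objects
  set H : ℕ := ⌈(3 * S) ^ 2 * x ^ ε₁ / M⌉₊ with hHdef
  have hHpos : 0 < (3 * S) ^ 2 * x ^ ε₁ / M := by positivity
  have hH1 : 1 ≤ H := Nat.one_le_iff_ne_zero.2 (Nat.ceil_pos.2 hHpos).ne'
  have hHle : (3 * S) ^ 2 * x ^ ε₁ / M ≤ H := Nat.le_ceil _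
  have h𝒬pos : ∀ q ∈ (BFI.mRange S Y).filter (fun q : ℕ => 0 < q), 0 < q :=
    fun q hq => (Finset.mem_filter.1 hq).2
  set L₀ : ℕ := ⌊2 * S + Y⌋₊ with hL₀def
  have hL₀le : (L₀ : ℝ) ≤ 2 * S + Y := Nat.floor_le (by linarith)
  have hL₀3S : (L₀ : ℝ) ≤ 3 * S := by linarith
  have hL₀3M : (L₀ : ℝ) ≤ 3 * M := by linarith
  have h𝒬sub : (BFI.mRange S Y).filter (fun q : ℕ => 0 < q) ⊆ Icc 1 L₀ := by
    intro q hq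
    rw [Finset.mem_filter, BFI.mem_mRange] at hq
    rw [Finset.mem_Icc]; exact ⟨hq.2, hq.1⟩
  have h𝒬fsub : ((BFI.mRange S Y).filter (fun q : ℕ => 0 < q)).filter
      (fun q : ℕ => IsCoprime (q : ℤ) (a₁ * a₂)) ⊆ Icc 1 L₀ := (Finset.filter_subset _ _).trans h𝒬sub
  have h𝒬f' : ∀ q ∈ ((BFI.mRange S Y).filter (fun q : ℕ => 0 < q)).filter
      (fun q : ℕ => IsCoprime (q : ℤ) (a₁ * a₂)), 0 < q ∧ IsCoprime (q : ℤ) (a₁ * a₂) := by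
    intro q hq
    rw [Finset.mem_filter] at hq
    exact ⟨(Finset.mem_filter.1 hq.1).2, hq.2⟩
  have hcard𝒬 : ((((BFI.mRange S Y).filter (fun q : ℕ => 0 < q)).filter
      (fun q : ℕ => IsCoprime (q : ℤ) (a₁ * a₂))).card : ℝ) ≤ 3 * S := by
    calc _ ≤ ((Icc 1 L₀).card : ℝ) := by exact_mod_cast Finset.card_le_card h𝒬fsub
      _ = L₀ := by simp
      _ ≤ 3 * S := hL₀3S
  have hγabs : ∀ q : ℕ, |BFI.bump S Y q| ≤ 1 := fun q => BFI.abs_bump_le_one hY0 hS0.le _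
  set Xn : ℕ := ⌊2 * N⌋₊ with hXndef
  have hXnle : (Xn : ℝ) ≤ 2 * N := Nat.floor_le (by linarith)
  have hn𝒩 : ∀ n ∈ (BFI.dyadic N).filter (fun n : ℕ => IsCoprime (n : ℤ) a₂),
      (1 : ℝ) ≤ n ∧ (n : ℝ) ≤ 2 * N := by
    intro n hn
    have h := (BFI.mem_dyadic hN0.le).1 (Finset.mem_filter.1 hn).1
    exact ⟨by linarith [h.1], h.2⟩
  have h𝒩fsub : (BFI.dyadic N).filter (fun n : ℕ => IsCoprime (n : ℤ) a₂) ⊆ Icc 1 Xn := by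
    intro n hn
    obtain ⟨h1, h2⟩ := hn𝒩 n hn
    rw [Finset.mem_Icc]
    exact ⟨by exact_mod_cast h1, Nat.le_floor h2⟩
  have h𝒩fle : ∀ n ∈ (BFI.dyadic N).filter (fun n : ℕ => IsCoprime (n : ℤ) a₂), n ≤ Xn :=
    fun n hn => (Finset.mem_Icc.1 (h𝒩fsub hn)).2
  have h𝒩f' : ∀ n ∈ (BFI.dyadic N).filter (fun n : ℕ => IsCoprime (n : ℤ) a₂), IsCoprime (n : ℤ) a₂ :=
    fun n hn => (Finset.mem_filter.1 hn).2
  -- `K = ⌊x^κ⌋`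
  set K : ℕ := ⌊x ^ κ⌋₊ with hKdef
  have hxκ2 : 2 ≤ x ^ κ := by have := hx₅ x hxx₅; rwa [pow_zero, mul_one] at this
  have hKle : (K : ℝ) ≤ x ^ κ := Nat.floor_le (by positivity)
  have hKge : x ^ κ / 2 ≤ K := by
    have := Nat.lt_floor_add_one (x ^ κ)
    rw [← hKdef] at this; linarith only [this, hxκ2]
  have hK1 : 1 ≤ K := (Nat.one_le_floor_iff _).2 (by linarith)
  have hKpos : (0 : ℝ) < K := by exact_mod_cast hK1
  -- ### divisor moment for `β` (truncation error)
  have hBs : ∑ n ∈ Icc 1 ⌊2 * N⌋₊, (σ 0 n : ℝ) ^ r ≤ CB * N * L ^ cd := by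
    have h := hCdle (2 * N) (by linarith only [hN1])
    have hlog : Real.log (2 * N) ≤ 2 * L := hlog2x _ (by linarith only [hN0]) (by linarith only [hNx, hx0])
    have hlog0 : 0 ≤ Real.log (2 * N) := Real.log_nonneg (by linarith only [hN1])
    refine h.trans ?_
    calc Cd * (2 * N) * Real.log (2 * N) ^ cd ≤ Cd * (2 * N) * (2 * L) ^ cd := by gcongr
      _ = CB * N * L ^ cd := by rw [hCBdef, mul_pow, pow_succ]; ring
  have hβ1 : ∑ n ∈ (BFI.dyadic N).filter (fun n : ℕ => IsCoprime (n : ℤ) a₂), ‖β n‖ ≤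
      ∑ n ∈ Icc 1 ⌊2 * N⌋₊, (σ 0 n : ℝ) ^ r :=
    sum_filter_dyadic_norm_le hN0 hrA hβ _
  have hβ10 : 0 ≤ ∑ n ∈ (BFI.dyadic N).filter (fun n : ℕ => IsCoprime (n : ℤ) a₂), ‖β n‖ :=
    Finset.sum_nonneg fun _ _ => norm_nonneg _
  have hBf : (∑ n ∈ (BFI.dyadic N).filter (fun n : ℕ => IsCoprime (n : ℤ) a₂), ‖β n‖) ^ 2 ≤
      (CB * N * L ^ cd) ^ 2 := pow_le_pow_left₀ hβ10 (hβ1.trans hBs) 2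
  -- ### pointwise bounds: `τ(k) ≤ τM` for `k ≤ x³`, `|β_n| ≤ Bi`
  set τM : ℝ := Cτ * x ^ (3 * ε) with hτMdef
  have hτM1 : 1 ≤ τM := one_le_mul_of_one_le_of_one_le hCτ1 (Real.one_le_rpow hx1 (by positivity))
  have hτM0 : 0 ≤ τM := zero_le_one.trans hτM1
  have hτk : ∀ k : ℕ, (k : ℝ) ≤ x ^ (3 : ℕ) → (σ 0 k : ℝ) ≤ τM := by
    intro k hk
    calc (σ 0 k : ℝ) ≤ Cτ * (k : ℝ) ^ ε := hCτ k
      _ ≤ Cτ * (x ^ (3 : ℕ)) ^ ε :=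
          mul_le_mul_of_nonneg_left (Real.rpow_le_rpow (Nat.cast_nonneg k) hk hε0.le)
            (zero_le_one.trans hCτ1)
      _ = τM := by rw [hτMdef, ← Real.rpow_natCast, ← Real.rpow_mul hx0.le]; norm_num
  set Bi : ℝ := Cβ ^ Aτ * x ^ (2 * ε) with hBidef
  have hBi1 : 1 ≤ Bi := one_le_mul_of_one_le_of_one_le hCβA (Real.one_le_rpow hx1 (by positivity))
  have hBi0 : 0 ≤ Bi := zero_le_one.trans hBi1
  have hβBi : ∀ n ∈ (BFI.dyadic N).filter (fun n : ℕ => IsCoprime (n : ℤ) a₂), ‖β n‖ ≤ Bi := by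
    intro n hn
    obtain ⟨hn1, hn2⟩ := hn𝒩 n hn
    have hnx2 : (n : ℝ) ≤ x ^ (2 : ℝ) := by
      rw [Real.rpow_two, sq]
      calc (n : ℝ) ≤ 2 * N := hn2
        _ ≤ 2 * x := by linarith only [hNx]
        _ ≤ x * x := by
            have : 0 ≤ (x - 2) * x := mul_nonneg (by linarith only [hx9]) hx0.le
            linarith only [this]
    have h1 : (σ 0 n : ℝ) ≤ Cβ * (x ^ (2 : ℝ)) ^ ε' :=
      (hCβ n).trans (mul_le_mul_of_nonneg_left
        (Real.rpow_le_rpow (Nat.cast_nonneg n) hnx2 hε'0.le) (zero_le_one.trans hCβ1))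
    have h2 : ((σ 0 n : ℝ)) ^ Aτ ≤ (Cβ * (x ^ (2 : ℝ)) ^ ε') ^ Aτ :=
      Real.rpow_le_rpow (Nat.cast_nonneg _) h1 hAτ
    calc ‖β n‖ ≤ (σ 0 n : ℝ) ^ Aτ := hβ n
      _ ≤ (Cβ * (x ^ (2 : ℝ)) ^ ε') ^ Aτ := h2
      _ = Cβ ^ Aτ * x ^ (2 * ε' * Aτ) := by
          rw [Real.mul_rpow (zero_le_one.trans hCβ1) (by positivity), ← Real.rpow_mul hx0.le,
            ← Real.rpow_mul hx0.le]
      _ ≤ Bi := mul_le_mul_of_nonneg_left (hmono hε'A) (zero_le_one.trans hCβA)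
  -- `Q` and its size
  set Q : ℝ := 32 * (τM + 1) * Bi ^ 2 * M * L ^ 2 with hQdef
  have hQ0 : 0 ≤ Q := by positivity
  have hQle : Q ≤ CQ * x ^ (7 * ε) * M * L ^ 2 := by
    have h1 : τM + 1 ≤ 2 * Cτ * x ^ (3 * ε) := by rw [hτMdef] at hτM1 ⊢; linarith only [hτM1]
    have e4 : 2 * ε + 2 * ε = 4 * ε := by ring
    have h2 : Bi ^ 2 = (Cβ ^ Aτ) ^ 2 * x ^ (4 * ε) := by
      rw [hBidef, mul_pow, sq (x ^ (2 * ε)), ← Real.rpow_add hx0, e4]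
    have e7 : (7 : ℝ) * ε = 3 * ε + 4 * ε := by ring
    calc Q = 32 * (τM + 1) * Bi ^ 2 * M * L ^ 2 := rfl
      _ ≤ 32 * (2 * Cτ * x ^ (3 * ε)) * Bi ^ 2 * M * L ^ 2 := by gcongr
      _ = CQ * x ^ (7 * ε) * M * L ^ 2 := by rw [h2, hCQdef, e7, Real.rpow_add hx0]; ring
  -- the truncation error
  set TW : ℝ := (3 * S) * (3 * S) * ((CB * N * L ^ cd) ^ 2 * (2 * In * x ^ (-6 : ℝ))) with hTWdef
  have hTW0 : 0 ≤ TW := by positivity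
  -- `A₀ = ∑ α(m) ≤ 7M/2`
  have hA0le : ∑ m ∈ BFI.mRange M (M / 2), BFI.bump M (M / 2) m ≤ 7 * M / 2 := by
    calc _ ≤ ∑ m ∈ BFI.mRange M (M / 2), (1 : ℝ) :=
          Finset.sum_le_sum fun m _ => (BFI.bump_mem_Icc hM2 hM0.le _).2
      _ = ((⌊2 * M + M / 2⌋₊ + 1 : ℕ) : ℝ) := by
          rw [Finset.sum_const, BFI.mRange, Finset.card_range]; simp
      _ ≤ (2 * M + M / 2) + 1 := by
          push_cast; linarith only [Nat.floor_le (show 0 ≤ 2 * M + M / 2 by positivity)]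
      _ ≤ 7 * M / 2 := by linarith only [hM1]
  have hA00 : 0 ≤ ∑ m ∈ BFI.mRange M (M / 2), BFI.bump M (M / 2) m :=
    Finset.sum_nonneg fun m _ => (BFI.bump_mem_Icc hM2 hM0.le _).1
  have hX'le : ((⌊2 * M + M / 2⌋₊ : ℕ) : ℝ) ≤ 5 * M / 2 :=
    (Nat.floor_le (by positivity)).trans (le_of_eq (by ring))
  have hL'0 : 0 ≤ 1 + Real.log L₀ := by have := Real.log_natCast_nonneg L₀; linarith only [this]
  have hL'3L : 1 + Real.log L₀ ≤ 3 * L := by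
    have := hlogle L₀ (Nat.cast_nonneg _) (by linarith only [hL₀3S, hSx1]); linarith only [this, hL1]
  -- the divisor hypothesis of `norm_S1piece_le`
  have hτhyp : ∀ m ∈ BFI.mRange M (M / 2), BFI.bump M (M / 2) m ≠ 0 →
      ∀ n₁ ∈ (BFI.dyadic N).filter (fun n : ℕ => IsCoprime (n : ℤ) a₂),
      (m : ℤ) * n₁ * a₂ - a₁ ≠ 0 ∧ (σ 0 (Int.natAbs ((m : ℤ) * n₁ * a₂ - a₁)) : ℝ) ≤ τM := by
    intro m hm hbm n₁ hn₁
    have hmle : (m : ℝ) ≤ 2 * M + M / 2 := by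
      have := BFI.mem_mRange.1 hm
      exact le_trans (by exact_mod_cast this) (Nat.floor_le (by positivity))
    have hmgt : M / 2 < m := by
      by_contra h
      exact hbm (BFI.bump_eq_zero_of_le hM2 hM0.le (by linarith only [not_lt.1 h]))
    obtain ⟨hn1, hn2⟩ := hn𝒩 n₁ hn₁
    have ha₂1 : (1 : ℝ) ≤ |(a₂ : ℝ)| := by exact_mod_cast Int.one_le_abs ha₂
    have hδle1 : δ ≤ 1 := by linarith only [hδ1]
    have ha₁1 : |(a₁ : ℝ)| ≤ x := ha₁x.trans (hle1 hδle1)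
    have ha₂x' : |(a₂ : ℝ)| ≤ x := ha₂x.trans (hle1 hδle1)
    have ha₁m : |(a₁ : ℝ)| < m := by
      have h1 : |(a₁ : ℝ)| ≤ x ^ (1 / 100 : ℝ) := ha₁x.trans (hmono hδ1)
      have h2 : x ^ (1 / 100 : ℝ) * 2 ≤ x ^ (33 / 50 : ℝ) := by
        calc x ^ (1 / 100 : ℝ) * 2 ≤ x ^ (1 / 100 : ℝ) * x ^ (1 / 2 : ℝ) :=
              mul_le_mul_of_nonneg_left hx2half (by positivity)
          _ = x ^ (51 / 100 : ℝ) := by rw [← Real.rpow_add hx0]; norm_num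
          _ ≤ x ^ (33 / 50 : ℝ) := hmono (by norm_num)
      linarith only [h1, h2, hMbig, hmgt]
    constructor
    · intro h0
      have e : (a₁ : ℝ) = (m : ℝ) * n₁ * a₂ := by
        have := sub_eq_zero.1 h0
        exact_mod_cast this.symm
      have : (m : ℝ) ≤ |(a₁ : ℝ)| := by
        rw [e, abs_mul, abs_mul, Nat.abs_cast, Nat.abs_cast]
        calc (m : ℝ) = m * 1 * 1 := by ring
          _ ≤ m * n₁ * |(a₂ : ℝ)| := by gcongr
      linarith only [this, ha₁m]
    · apply hτk
      rw [Nat.cast_natAbs]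
      push_cast
      have e5 : (2 * M + M / 2) * (2 * N) = 5 * x := by rw [← hMN]; ring
      have hm0 : (0 : ℝ) ≤ m := Nat.cast_nonneg _
      have hmn : (m : ℝ) * n₁ ≤ (2 * M + M / 2) * (2 * N) :=
        mul_le_mul hmle hn2 (by linarith only [hn1]) (by positivity)
      have hcube : 5 * x * x + x ≤ x ^ (3 : ℕ) := by
        have h1 : 0 ≤ (x - 9) * (x + 4) := mul_nonneg (by linarith only [hx9]) (by linarith only [hx9])
        have h2 : 0 ≤ x * ((x - 9) * (x + 4) + 35) := mul_nonneg hx0.le (by linarith only [h1])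
        have e : x ^ (3 : ℕ) - (5 * x * x + x) = x * ((x - 9) * (x + 4) + 35) := by ring
        linarith only [h2, e]
      calc |(m : ℝ) * n₁ * a₂ - a₁| ≤ |(m : ℝ) * n₁ * a₂| + |(a₁ : ℝ)| := abs_sub _ _
        _ = m * n₁ * |(a₂ : ℝ)| + |(a₁ : ℝ)| := by rw [abs_mul, abs_mul, Nat.abs_cast, Nat.abs_cast]
        _ ≤ (2 * M + M / 2) * (2 * N) * x + x :=
            add_le_add (mul_le_mul hmn ha₂x' (abs_nonneg _) (by positivity)) ha₁1
        _ = 5 * x * x + x := by rw [e5]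
        _ ≤ x ^ (3 : ℕ) := hcube
  have hwt1 : ∀ q₀ n₀ q₁ q₂ n₁ n₂ : ℕ,
      ‖(if (Nat.gcd q₁ q₂ = q₀ ∧ Nat.gcd n₁ n₂ = n₀) then (1 : ℂ) else 0)‖ ≤ 1 := by
    intros; split_ifs <;> simp
  -- ### the truncation error, per pair of moduli
  have hpair : ∀ q₁ ∈ ((BFI.mRange S Y).filter (fun q : ℕ => 0 < q)).filter
        (fun q : ℕ => IsCoprime (q : ℤ) (a₁ * a₂)),
      ∀ q₂ ∈ ((BFI.mRange S Y).filter (fun q : ℕ => 0 < q)).filter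
        (fun q : ℕ => IsCoprime (q : ℤ) (a₁ * a₂)),
        M / (Nat.lcm q₁ q₂ : ℝ) * (2 * In * ((Nat.lcm q₁ q₂ : ℝ) / (2 * π * M)) ^ nI *
          (((H : ℝ) ^ (nI - 1)))⁻¹) ≤ 2 * In * x ^ (-6 : ℝ) := by
    intro q₁ hq₁ q₂ hq₂
    have hq₁' := Finset.mem_Icc.1 (h𝒬fsub hq₁)
    have hq₂' := Finset.mem_Icc.1 (h𝒬fsub hq₂)
    set W : ℕ := Nat.lcm q₁ q₂ with hWdef
    have hW : 0 < W := Nat.lcm_pos hq₁'.1 hq₂'.1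
    have hWr : (0 : ℝ) < W := by exact_mod_cast hW
    have hW9 : (W : ℝ) ≤ (3 * S) ^ 2 := by
      have h1 : (W : ℝ) ≤ (q₁ : ℝ) * q₂ := by
        exact_mod_cast Nat.le_of_dvd (Nat.mul_pos hq₁'.1 hq₂'.1) (Nat.lcm_dvd_mul q₁ q₂)
      have h2 : (q₁ : ℝ) * q₂ ≤ (3 * S) * (3 * S) :=
        mul_le_mul (le_trans (by exact_mod_cast hq₁'.2) hL₀3S)
          (le_trans (by exact_mod_cast hq₂'.2) hL₀3S) (Nat.cast_nonneg _) (by positivity)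
      exact h1.trans (h2.trans (le_of_eq (by ring)))
    have hWH : (W : ℝ) / M * x ^ ε₁ ≤ H := by
      refine le_trans ?_ hHle
      rw [div_mul_eq_mul_div]
      exact div_le_div_of_nonneg_right (mul_le_mul_of_nonneg_right hW9 (by positivity)) hM0.le
    have hD0 : 0 < (W : ℝ) / M := div_pos hWr hM0
    have hπ : (1 : ℝ) ≤ 2 * π := by have := Real.pi_gt_three; linarith only [this]
    have h1 : M / (W : ℝ) * ((W : ℝ) / (2 * π * M)) ^ nI ≤ ((W : ℝ) / M) ^ (nI - 1) := by
      have e : ((W : ℝ) / (2 * π * M)) ^ nI = ((W : ℝ) / M) ^ nI * ((2 * π) ^ nI)⁻¹ := by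
        rw [show (W : ℝ) / (2 * π * M) = ((W : ℝ) / M) * (2 * π)⁻¹ by field_simp, mul_pow, inv_pow]
      rw [e]
      have h2 : ((2 * π) ^ nI : ℝ)⁻¹ ≤ 1 := inv_le_one_of_one_le₀ (one_le_pow₀ hπ)
      have h3 : M / (W : ℝ) * ((W : ℝ) / M) ^ nI = ((W : ℝ) / M) ^ (nI - 1) := by
        obtain ⟨k, hk⟩ : ∃ k, nI = k + 1 := ⟨nI - 1, by omega⟩
        rw [hk, pow_succ, Nat.add_sub_cancel]
        field_simp
      calc M / (W : ℝ) * (((W : ℝ) / M) ^ nI * ((2 * π) ^ nI)⁻¹)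
          = (M / (W : ℝ) * ((W : ℝ) / M) ^ nI) * ((2 * π) ^ nI)⁻¹ := by ring
        _ ≤ (M / (W : ℝ) * ((W : ℝ) / M) ^ nI) * 1 :=
            mul_le_mul_of_nonneg_left h2 (by positivity)
        _ = ((W : ℝ) / M) ^ (nI - 1) := by rw [mul_one, h3]
    have h2 : ((W : ℝ) / M) ^ (nI - 1) * (((H : ℝ) ^ (nI - 1)))⁻¹ ≤ x ^ (-6 : ℝ) := by
      have hHr : (0 : ℝ) < H := by exact_mod_cast hH1
      have hA : ((W : ℝ) / M) ^ (nI - 1) ≤ (H : ℝ) ^ (nI - 1) * x ^ (-6 : ℝ) := by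
        calc ((W : ℝ) / M) ^ (nI - 1) = (((W : ℝ) / M * x ^ ε₁) * x ^ (-ε₁)) ^ (nI - 1) := by
              congr 1
              rw [mul_assoc, ← Real.rpow_add hx0, add_neg_cancel, Real.rpow_zero, mul_one]
          _ = ((W : ℝ) / M * x ^ ε₁) ^ (nI - 1) * (x ^ (-ε₁)) ^ (nI - 1) := mul_pow _ _ _
          _ ≤ (H : ℝ) ^ (nI - 1) * (x ^ (-ε₁)) ^ (nI - 1) :=
              mul_le_mul_of_nonneg_right (pow_le_pow_left₀ (by positivity) hWH _) (by positivity)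
          _ ≤ (H : ℝ) ^ (nI - 1) * x ^ (-6 : ℝ) := by
              refine mul_le_mul_of_nonneg_left ?_ (by positivity)
              rw [← Real.rpow_natCast, ← Real.rpow_mul hx0.le, Nat.cast_sub (by omega), Nat.cast_one]
              refine Real.rpow_le_rpow_of_exponent_le hx1 ?_
              have e : -ε₁ * ((nI : ℝ) - 1) = -(ε₁ * ((nI : ℝ) - 1)) := by ring
              rw [e]; linarith only [hnIε]
      calc ((W : ℝ) / M) ^ (nI - 1) * (((H : ℝ) ^ (nI - 1)))⁻¹
          ≤ ((H : ℝ) ^ (nI - 1) * x ^ (-6 : ℝ)) * (((H : ℝ) ^ (nI - 1)))⁻¹ :=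
            mul_le_mul_of_nonneg_right hA (by positivity)
        _ = x ^ (-6 : ℝ) := by field_simp
    calc M / (W : ℝ) * (2 * In * ((W : ℝ) / (2 * π * M)) ^ nI * (((H : ℝ) ^ (nI - 1)))⁻¹)
        = 2 * In * ((M / (W : ℝ) * ((W : ℝ) / (2 * π * M)) ^ nI) * (((H : ℝ) ^ (nI - 1)))⁻¹) := by
          ring
      _ ≤ 2 * In * (((W : ℝ) / M) ^ (nI - 1) * (((H : ℝ) ^ (nI - 1)))⁻¹) := by
          refine mul_le_mul_of_nonneg_left (mul_le_mul_of_nonneg_right h1 (by positivity)) (by positivity)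
      _ ≤ 2 * In * x ^ (-6 : ℝ) := mul_le_mul_of_nonneg_left h2 (by positivity)
  have htail : ∑ q₁ ∈ ((BFI.mRange S Y).filter (fun q : ℕ => 0 < q)).filter
        (fun q : ℕ => IsCoprime (q : ℤ) (a₁ * a₂)),
      ∑ q₂ ∈ ((BFI.mRange S Y).filter (fun q : ℕ => 0 < q)).filter
        (fun q : ℕ => IsCoprime (q : ℤ) (a₁ * a₂)), |BFI.bump S Y q₁ * BFI.bump S Y q₂| *
        ((∑ n ∈ (BFI.dyadic N).filter (fun n : ℕ => IsCoprime (n : ℤ) a₂), ‖β n‖) ^ 2 *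
          (M / (Nat.lcm q₁ q₂ : ℝ) * (2 * In * ((Nat.lcm q₁ q₂ : ℝ) / (2 * π * M)) ^ nI *
            (((H : ℝ) ^ (nI - 1)))⁻¹))) ≤ TW := by
    have hterm : ∀ q₁ ∈ ((BFI.mRange S Y).filter (fun q : ℕ => 0 < q)).filter
          (fun q : ℕ => IsCoprime (q : ℤ) (a₁ * a₂)),
        ∀ q₂ ∈ ((BFI.mRange S Y).filter (fun q : ℕ => 0 < q)).filter
          (fun q : ℕ => IsCoprime (q : ℤ) (a₁ * a₂)), |BFI.bump S Y q₁ * BFI.bump S Y q₂| *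
          ((∑ n ∈ (BFI.dyadic N).filter (fun n : ℕ => IsCoprime (n : ℤ) a₂), ‖β n‖) ^ 2 *
            (M / (Nat.lcm q₁ q₂ : ℝ) * (2 * In * ((Nat.lcm q₁ q₂ : ℝ) / (2 * π * M)) ^ nI *
              (((H : ℝ) ^ (nI - 1)))⁻¹))) ≤ (CB * N * L ^ cd) ^ 2 * (2 * In * x ^ (-6 : ℝ)) := by
      intro q₁ hq₁ q₂ hq₂
      have hγ1 : |BFI.bump S Y q₁ * BFI.bump S Y q₂| ≤ 1 := by
        rw [abs_mul]; exact mul_le_one₀ (hγabs q₁) (abs_nonneg _) (hγabs q₂)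
      calc _ ≤ 1 * ((CB * N * L ^ cd) ^ 2 * (2 * In * x ^ (-6 : ℝ))) := by
            refine mul_le_mul hγ1 (mul_le_mul hBf (hpair q₁ hq₁ q₂ hq₂) (by positivity)
              (by positivity)) (by positivity) zero_le_one
        _ = _ := one_mul _
    refine (Finset.sum_le_sum fun q₁ hq₁ => Finset.sum_le_sum fun q₂ hq₂ => hterm q₁ hq₁ q₂ hq₂).trans ?_
    rw [Finset.sum_const, Finset.sum_const, nsmul_eq_mul, nsmul_eq_mul, hTWdef]
    have h0 : 0 ≤ (CB * N * L ^ cd) ^ 2 * (2 * In * x ^ (-6 : ℝ)) := by positivity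
    calc _ ≤ (3 * S) * ((3 * S) * ((CB * N * L ^ cd) ^ 2 * (2 * In * x ^ (-6 : ℝ)))) := by
          refine mul_le_mul hcard𝒬 (mul_le_mul hcard𝒬 le_rfl h0 (by positivity)) ?_ (by positivity)
          exact mul_nonneg (Nat.cast_nonneg _) h0
      _ = _ := by ring
  -- ### the pieces `ℛ₁(q₀,n₀)`
  set CA : ℝ := max C₁ 0 * M * N ^ 2 * x ^ (-3 * κ) with hCAdef
  have hCA0 : 0 ≤ CA :=
    mul_nonneg (mul_nonneg (mul_nonneg (le_max_right _ _) hM0.le) (sq_nonneg _)) (Real.rpow_nonneg hx0.le _)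
  have hSx₁ : S ≤ x ^ (1 / 2 + δ₁) := hSx.trans (hmono (by linarith only [hδ₁']))
  have hRd₁ : Rd ≤ x ^ δ₁ := hRd.trans (hmono hδ₁')
  have hY1₁ : S * x ^ (-δ₁) ≤ Y :=
    le_trans (mul_le_mul_of_nonneg_left (hmono (by linarith only [hδ₁'])) hS0.le) hY1
  have ha₁₁ : (|a₁| : ℝ) ≤ x ^ δ₁ := ha₁x.trans (hmono hδ₁')
  have ha₂₁ : (|a₂| : ℝ) ≤ x ^ δ₁ := ha₂x.trans (hmono hδ₁')
  have hRwt : ∀ q₀ ∈ Icc 1 L₀, ∀ n₀ ∈ Icc 1 Xn,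
      ‖∑ q₁ ∈ ((BFI.mRange S Y).filter (fun q : ℕ => 0 < q)).filter
            (fun q : ℕ => IsCoprime (q : ℤ) (a₁ * a₂)),
        ∑ q₂ ∈ ((BFI.mRange S Y).filter (fun q : ℕ => 0 < q)).filter
            (fun q : ℕ => IsCoprime (q : ℤ) (a₁ * a₂)),
          ((BFI.bump S Y q₁ : ℝ) : ℂ) * ((BFI.bump S Y q₂ : ℝ) : ℂ) *
          ∑ n₁ ∈ (BFI.dyadic N).filter (fun n : ℕ => IsCoprime (n : ℤ) a₂),
            ∑ n₂ ∈ (BFI.dyadic N).filter (fun n : ℕ => IsCoprime (n : ℤ) a₂),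
              (if (Nat.gcd q₁ q₂ = q₀ ∧ Nat.gcd n₁ n₂ = n₀) then (1 : ℂ) else 0) *
                (β n₁ * starRingEnd ℂ (β n₂)) *
              ((M : ℂ) / (Nat.lcm q₁ q₂ : ℂ) *
                ∑ b ∈ (Finset.range (Nat.lcm q₁ q₂)).filter (fun b : ℕ =>
                    (b : ZMod q₁) * ((n₁ : ZMod q₁) * (a₂ : ZMod q₁)) = (a₁ : ZMod q₁) ∧
                    (b : ZMod q₂) * ((n₂ : ZMod q₂) * (a₂ : ZMod q₂)) = (a₁ : ZMod q₂)),
                  ∑ h ∈ Finset.Icc (-(H : ℤ)) H, (if ((Nat.lcm q₁ q₂ : ℕ) : ℤ) ∣ h then 0 else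
                    𝓕 (BFI.bumpC 1 (1 / 2)) (M * h / (Nat.lcm q₁ q₂ : ℕ)) *
                      (𝐞 ((b : ℝ) * h / (Nat.lcm q₁ q₂ : ℕ)) : ℂ)))‖ ≤
      (if (q₀ ≤ K ∧ n₀ ≤ K) then CA else 0) +
        Q * (4 * N ^ 2) * (if (K : ℝ) < max (q₀ : ℝ) (n₀ : ℝ) then
          (((q₀ : ℝ)) ^ 2)⁻¹ * (((n₀ : ℝ)) ^ 2)⁻¹ else 0) +
        Q * (4 * N * ((q₀ : ℝ))⁻¹ * ((n₀ : ℝ))⁻¹ + ((q₀ : ℝ))⁻¹) + TW := by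
    intro q₀ hq₀ n₀ hn₀
    have hq₀' := Finset.mem_Icc.1 hq₀
    have hn₀' := Finset.mem_Icc.1 hn₀
    have hq₀pos : 0 < q₀ := hq₀'.1
    have hn₀pos : 0 < n₀ := hn₀'.1
    have hq₀r : (1 : ℝ) ≤ q₀ := by exact_mod_cast hq₀'.1
    have hn₀r : (1 : ℝ) ≤ n₀ := by exact_mod_cast hn₀'.1
    have hB0' : 0 ≤ Q * (4 * N ^ 2) * (if (K : ℝ) < max (q₀ : ℝ) (n₀ : ℝ) then
        (((q₀ : ℝ)) ^ 2)⁻¹ * (((n₀ : ℝ)) ^ 2)⁻¹ else 0) := by positivity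
    have hC0' : 0 ≤ Q * (4 * N * ((q₀ : ℝ))⁻¹ * ((n₀ : ℝ))⁻¹ + ((q₀ : ℝ))⁻¹) := by positivity
    have hA0' : 0 ≤ (if (q₀ ≤ K ∧ n₀ ≤ K) then CA else 0) := by split_ifs <;> [exact hCA0; exact le_rfl]
    -- the three-term bound
    have hR := norm_R1piece_le a₁ a₂ h𝒬pos (BFI.dyadic N) (fun q : ℕ => BFI.bump S Y q) β
      (wt := fun q₁ q₂ n₁ n₂ => if (Nat.gcd q₁ q₂ = q₀ ∧ Nat.gcd n₁ n₂ = n₀) then (1 : ℂ) else 0)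
      (hwt1 q₀ n₀) hM0 hH1 hnI2
    beta_reduce at hR
    by_cases hall : Nat.Coprime q₀ n₀ ∧ IsCoprime (q₀ : ℤ) (a₁ * a₂) ∧ IsCoprime (n₀ : ℤ) a₂
    · by_cases hsmall : q₀ ≤ K ∧ n₀ ≤ K
      · -- small good pairs: the hypothesis
        rw [if_pos hsmall]
        have hq₀κ : (q₀ : ℝ) ≤ x ^ κ := le_trans (by exact_mod_cast hsmall.1) hKle
        have hn₀κ : (n₀ : ℝ) ≤ x ^ κ := le_trans (by exact_mod_cast hsmall.2) hKle
        have h := HC1 x hxx₁ M N S Rd Y hMN hN hNS hS hSx₁ hRd1 hRd₁ hY1₁ hY4 a₁ a₂ ha₁ ha₂ ha₁₁ ha₂₁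
          β hβ hβs q₀ n₀ hq₀pos hq₀κ hn₀pos hn₀κ hall.1 hall.2.1 hall.2.2
        have h' : C₁ * M * N ^ 2 * x ^ (-3 * κ) ≤ CA := by
          rw [hCAdef]
          refine mul_le_mul_of_nonneg_right (mul_le_mul_of_nonneg_right
            (mul_le_mul_of_nonneg_right (le_max_left _ _) hM0.le) (sq_nonneg _)) (Real.rpow_nonneg hx0.le _)
        refine h.trans (h'.trans ?_)
        linarith only [hB0', hC0', hTW0]
      · -- large good pairs: trivial bounds
        rw [if_neg hsmall, zero_add]
        have hKmax : (K : ℝ) < max (q₀ : ℝ) (n₀ : ℝ) := by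
          rcases not_and_or.1 hsmall with h | h
          · exact lt_max_of_lt_left (by exact_mod_cast not_le.1 h)
          · exact lt_max_of_lt_right (by exact_mod_cast not_le.1 h)
        rw [if_pos hKmax]
        have hT := norm_S1piece_le h𝒬f' hγabs ((BFI.dyadic N).filter (fun n : ℕ => IsCoprime (n : ℤ) a₂))
          hBi0 hβBi q₀ n₀ hM0 hτM0 hτhyp
        have hX := norm_X1piece_le h𝒬fsub hγabs ((BFI.dyadic N).filter (fun n : ℕ => IsCoprime (n : ℤ) a₂))
          hBi0 hβBi hq₀pos n₀
        beta_reduce at hT hX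
        have hPc := card_pairs_le h𝒩fle hn₀pos hq₀pos (Nat.Coprime.symm hall.1)
        have hSq := sum_filter_dvd_div_add_one_le h𝒬fsub hq₀pos (⌊2 * M + M / 2⌋₊)
        have hPreal : (((((BFI.dyadic N).filter (fun n : ℕ => IsCoprime (n : ℤ) a₂)) ×ˢ
            ((BFI.dyadic N).filter (fun n : ℕ => IsCoprime (n : ℤ) a₂))).filter (fun p : ℕ × ℕ =>
              n₀ ∣ p.1 ∧ n₀ ∣ p.2 ∧ (p.1 : ZMod q₀) = (p.2 : ZMod q₀))).card : ℝ) ≤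
            (2 * N / n₀ + 1) * (2 * N / (n₀ * q₀) + 1) := by
          refine le_trans (b := (((Xn / n₀ + 1) * (Xn / (n₀ * q₀) + 1) : ℕ) : ℝ))
            (by exact_mod_cast hPc) ?_
          have h1 : (((Xn / n₀ : ℕ)) : ℝ) ≤ 2 * N / n₀ :=
            Nat.cast_div_le.trans (div_le_div_of_nonneg_right hXnle (by positivity))
          have h2 : (((Xn / (n₀ * q₀) : ℕ)) : ℝ) ≤ 2 * N / (n₀ * q₀) := by
            refine Nat.cast_div_le.trans ?_
            push_cast
            exact div_le_div_of_nonneg_right hXnle (by positivity)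
          push_cast
          gcongr
        have hSq' : ∑ q₂ ∈ (((BFI.mRange S Y).filter (fun q : ℕ => 0 < q)).filter
            (fun q : ℕ => IsCoprime (q : ℤ) (a₁ * a₂))).filter (fun q : ℕ => q₀ ∣ q),
            ((((⌊2 * M + M / 2⌋₊ / q₂ : ℕ)) : ℝ) + 1) ≤
            (((⌊2 * M + M / 2⌋₊ : ℕ) : ℝ) * (1 + Real.log L₀) + L₀) / q₀ := by
          refine hSq.trans ?_
          rw [add_div]
          exact add_le_add le_rfl Nat.cast_div_le
        have hAX : (∑ m ∈ BFI.mRange M (M / 2), BFI.bump M (M / 2) m) *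
            ‖∑ q₁ ∈ ((BFI.mRange S Y).filter (fun q : ℕ => 0 < q)).filter
                (fun q : ℕ => IsCoprime (q : ℤ) (a₁ * a₂)),
              ∑ q₂ ∈ ((BFI.mRange S Y).filter (fun q : ℕ => 0 < q)).filter
                (fun q : ℕ => IsCoprime (q : ℤ) (a₁ * a₂)),
                ((BFI.bump S Y q₁ * BFI.bump S Y q₂ / (Nat.lcm q₁ q₂ : ℝ) : ℝ) : ℂ) *
                ∑ n₁ ∈ ((BFI.dyadic N).filter (fun n : ℕ => IsCoprime (n : ℤ) a₂)).filter
                    (fun n => n.Coprime q₁),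
                  ∑ n₂ ∈ ((BFI.dyadic N).filter (fun n : ℕ => IsCoprime (n : ℤ) a₂)).filter
                    (fun n => n.Coprime q₂),
                    (if (n₁ : ZMod (Nat.gcd q₁ q₂)) = (n₂ : ZMod (Nat.gcd q₁ q₂)) then
                      (if (Nat.gcd q₁ q₂ = q₀ ∧ Nat.gcd n₁ n₂ = n₀) then (1 : ℂ) else 0) *
                        (β n₁ * starRingEnd ℂ (β n₂)) else 0)‖ ≤
            (∑ m ∈ BFI.mRange M (M / 2), BFI.bump M (M / 2) m) *
              (Bi ^ 2 * ((1 + Real.log L₀) ^ 2 / q₀) *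
                (((((BFI.dyadic N).filter (fun n : ℕ => IsCoprime (n : ℤ) a₂)) ×ˢ
                  ((BFI.dyadic N).filter (fun n : ℕ => IsCoprime (n : ℤ) a₂))).filter
                    (fun p : ℕ × ℕ => n₀ ∣ p.1 ∧ n₀ ∣ p.2 ∧ (p.1 : ZMod q₀) = (p.2 : ZMod q₀))).card : ℝ)) :=
          mul_le_mul_of_nonneg_left hX hA00
        have key := trivial_pieces_alg hT hSq' hAX hPreal (Nat.cast_nonneg _) hX'le (Nat.cast_nonneg _)
          hL₀3M hA0le hL'0 hL'3L hL1 hτM0 hq₀r hn₀r hN0.le hM0.le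
        have e : 32 * (τM + 1) * Bi ^ 2 * M * L ^ 2 *
            (4 * N ^ 2 * ((q₀ : ℝ) ^ 2)⁻¹ * ((n₀ : ℝ) ^ 2)⁻¹ + 4 * N * ((q₀ : ℝ))⁻¹ * ((n₀ : ℝ))⁻¹ +
              ((q₀ : ℝ))⁻¹) + TW = Q * (4 * N ^ 2) * (((q₀ : ℝ) ^ 2)⁻¹ * ((n₀ : ℝ) ^ 2)⁻¹) +
            Q * (4 * N * ((q₀ : ℝ))⁻¹ * ((n₀ : ℝ))⁻¹ + ((q₀ : ℝ))⁻¹) + TW := by rw [hQdef]; ring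
        exact hR.trans ((add_le_add key htail).trans e.le)
    · -- bad pairs: both pieces vanish
      have hT0 := S1piece_eq_zero h𝒬f' h𝒩f' (fun q : ℕ => BFI.bump S Y q) β M hall
      have hX0 := X1piece_eq_zero h𝒬f' h𝒩f' (fun q : ℕ => BFI.bump S Y q) β hall
      beta_reduce at hT0 hX0
      rw [hT0, hX0, norm_zero, mul_zero, zero_add, zero_add] at hR
      refine hR.trans (htail.trans ?_)
      linarith only [hA0', hB0', hC0']
  -- ### partition and summation
  have hpart := sum_gcd_partition' _ _ h𝒬fsub h𝒩fsub
    (fun q₁ q₂ => ((BFI.bump S Y q₁ : ℝ) : ℂ) * ((BFI.bump S Y q₂ : ℝ) : ℂ))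
    (fun n₁ n₂ => β n₁ * starRingEnd ℂ (β n₂))
    (fun q₁ q₂ n₁ n₂ => (M : ℂ) / (Nat.lcm q₁ q₂ : ℂ) *
      ∑ b ∈ (Finset.range (Nat.lcm q₁ q₂)).filter (fun b : ℕ =>
          (b : ZMod q₁) * ((n₁ : ZMod q₁) * (a₂ : ZMod q₁)) = (a₁ : ZMod q₁) ∧
          (b : ZMod q₂) * ((n₂ : ZMod q₂) * (a₂ : ZMod q₂)) = (a₁ : ZMod q₂)),
        ∑ h ∈ Finset.Icc (-(H : ℤ)) H, (if ((Nat.lcm q₁ q₂ : ℕ) : ℤ) ∣ h then 0 else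
          𝓕 (BFI.bumpC 1 (1 / 2)) (M * h / (Nat.lcm q₁ q₂ : ℕ)) *
            (𝐞 ((b : ℝ) * h / (Nat.lcm q₁ q₂ : ℕ)) : ℂ)))
  beta_reduce at hpart
  rw [hpart]
  refine (norm_sum_le _ _).trans ((Finset.sum_le_sum fun q₀ hq₀ => (norm_sum_le _ _).trans
    (Finset.sum_le_sum fun n₀ hn₀ => hRwt q₀ hq₀ n₀ hn₀)).trans ?_)
  -- the four sums
  rw [Finset.sum_congr rfl fun q₀ _ => Finset.sum_add_distrib, Finset.sum_add_distrib,
    Finset.sum_congr rfl fun q₀ _ => Finset.sum_add_distrib, Finset.sum_add_distrib,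
    Finset.sum_congr rfl fun q₀ _ => Finset.sum_add_distrib, Finset.sum_add_distrib]
  have hSA : ∑ q₀ ∈ Icc 1 L₀, ∑ n₀ ∈ Icc 1 Xn, (if (q₀ ≤ K ∧ n₀ ≤ K) then CA else 0) ≤ CA * K * K := by
    calc ∑ q₀ ∈ Icc 1 L₀, ∑ n₀ ∈ Icc 1 Xn, (if (q₀ ≤ K ∧ n₀ ≤ K) then CA else 0)
        = ∑ q₀ ∈ Icc 1 L₀, (if q₀ ≤ K then ∑ n₀ ∈ Icc 1 Xn, (if n₀ ≤ K then CA else 0) else 0) := by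
          refine Finset.sum_congr rfl fun q₀ _ => ?_
          split_ifs with h
          · exact Finset.sum_congr rfl fun n₀ _ => by simp [h]
          · exact Finset.sum_eq_zero fun n₀ _ => if_neg (fun h' => h h'.1)
      _ ≤ ∑ q₀ ∈ Icc 1 L₀, (if q₀ ≤ K then CA * K else 0) := by
          refine Finset.sum_le_sum fun q₀ _ => ?_
          split_ifs
          · exact sum_Icc_ite_le_le Xn K hCA0
          · exact le_rfl
      _ ≤ (CA * K) * K := sum_Icc_ite_le_le L₀ K (by positivity)
      _ = CA * K * K := by ring
  have hSB : ∑ q₀ ∈ Icc 1 L₀, ∑ n₀ ∈ Icc 1 Xn, Q * (4 * N ^ 2) *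
      (if (K : ℝ) < max (q₀ : ℝ) (n₀ : ℝ) then (((q₀ : ℝ)) ^ 2)⁻¹ * (((n₀ : ℝ)) ^ 2)⁻¹ else 0) ≤
      Q * (4 * N ^ 2) * (8 / K) := by
    rw [show (∑ q₀ ∈ Icc 1 L₀, ∑ n₀ ∈ Icc 1 Xn, Q * (4 * N ^ 2) *
        (if (K : ℝ) < max (q₀ : ℝ) (n₀ : ℝ) then (((q₀ : ℝ)) ^ 2)⁻¹ * (((n₀ : ℝ)) ^ 2)⁻¹ else 0)) =
        Q * (4 * N ^ 2) * ∑ q₀ ∈ Icc 1 L₀, ∑ n₀ ∈ Icc 1 Xn,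
          (if (K : ℝ) < max (q₀ : ℝ) (n₀ : ℝ) then (((q₀ : ℝ)) ^ 2)⁻¹ * (((n₀ : ℝ)) ^ 2)⁻¹ else 0) from by
      rw [Finset.mul_sum]; exact Finset.sum_congr rfl fun _ _ => by rw [Finset.mul_sum]]
    exact mul_le_mul_of_nonneg_left (sum_sum_ite_max_inv_sq_le L₀ Xn hKpos) (by positivity)
  have hSC : ∑ q₀ ∈ Icc 1 L₀, ∑ n₀ ∈ Icc 1 Xn, Q * (4 * N * ((q₀ : ℝ))⁻¹ * ((n₀ : ℝ))⁻¹ + ((q₀ : ℝ))⁻¹) ≤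
      Q * (42 * N * L ^ 2) := by
    rw [show (∑ q₀ ∈ Icc 1 L₀, ∑ n₀ ∈ Icc 1 Xn, Q * (4 * N * ((q₀ : ℝ))⁻¹ * ((n₀ : ℝ))⁻¹ + ((q₀ : ℝ))⁻¹)) =
        Q * ∑ q₀ ∈ Icc 1 L₀, ∑ n₀ ∈ Icc 1 Xn, (4 * N * ((q₀ : ℝ))⁻¹ * ((n₀ : ℝ))⁻¹ + ((q₀ : ℝ))⁻¹) from by
      rw [Finset.mul_sum]; exact Finset.sum_congr rfl fun _ _ => by rw [Finset.mul_sum]]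
    refine mul_le_mul_of_nonneg_left ((sum_sum_inv_add_le L₀ Xn hN0.le).trans ?_) hQ0
    have h1 : 1 + Real.log Xn ≤ 3 * L := by
      have := hlogle Xn (Nat.cast_nonneg _) (by linarith only [hXnle, hNx]); linarith only [this, hL1]
    have h2 : 4 * N * (1 + Real.log Xn) + Xn ≤ 4 * N * (3 * L) + 2 * N := by
      have := mul_le_mul_of_nonneg_left h1 (show 0 ≤ 4 * N by positivity); linarith only [this, hXnle]
    have h3 : 0 ≤ 4 * N * (1 + Real.log Xn) + Xn := by
      have := Real.log_natCast_nonneg Xn; positivity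
    have hNL : N * L ≤ N * L ^ 2 := by
      have : 0 ≤ N * L * (L - 1) := mul_nonneg (mul_nonneg hN0.le hL0.le) (by linarith only [hL1])
      linarith only [this, show N * L * (L - 1) = N * L ^ 2 - N * L by ring]
    calc (1 + Real.log L₀) * (4 * N * (1 + Real.log Xn) + Xn) ≤ (3 * L) * (4 * N * (3 * L) + 2 * N) :=
          mul_le_mul hL'3L h2 h3 (by positivity)
      _ = 36 * N * L ^ 2 + 6 * (N * L) := by ring
      _ ≤ 36 * N * L ^ 2 + 6 * (N * L ^ 2) := by linarith only [hNL]
      _ = 42 * N * L ^ 2 := by ring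
  have hSD : ∑ q₀ ∈ Icc 1 L₀, ∑ n₀ ∈ Icc 1 Xn, TW = (L₀ : ℝ) * Xn * TW := by
    simp only [Finset.sum_const, Nat.card_Icc, Nat.add_sub_cancel, nsmul_eq_mul]; ring
  -- ### the four bounds against `M N² L⁴ / Rd²`
  have hbase : 0 ≤ M * N ^ 2 * L ^ 4 / Rd ^ 2 := by positivity
  have hL4 : 1 ≤ L ^ 4 := one_le_pow₀ hL1
  have hL24 : L ^ 2 ≤ L ^ 4 := pow_le_pow_right₀ hL1 (by norm_num)
  -- (A)
  have hA : CA * K * K ≤ max C₁ 0 * (M * N ^ 2 * L ^ 4 / Rd ^ 2) := by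
    have hRdκ : Rd ^ 2 ≤ x ^ κ := hRd2δ.trans (hmono (by linarith only [hδκ, hκ]))
    have h1 : x ^ (-3 * κ) * ((K : ℝ) * K) ≤ (Rd ^ 2)⁻¹ := by
      calc x ^ (-3 * κ) * ((K : ℝ) * K) ≤ x ^ (-3 * κ) * (x ^ κ * x ^ κ) := by gcongr
        _ = (x ^ κ)⁻¹ := by
            rw [← Real.rpow_add hx0, ← Real.rpow_add hx0, ← Real.rpow_neg hx0.le]; ring_nf
        _ ≤ (Rd ^ 2)⁻¹ := by rw [inv_le_inv₀ (by positivity) (by positivity)]; exact hRdκ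
    calc CA * K * K = max C₁ 0 * (M * N ^ 2) * (x ^ (-3 * κ) * ((K : ℝ) * K)) := by rw [hCAdef]; ring
      _ ≤ max C₁ 0 * (M * N ^ 2) * (Rd ^ 2)⁻¹ := mul_le_mul_of_nonneg_left h1 (by positivity)
      _ = max C₁ 0 * (M * N ^ 2 / Rd ^ 2) * 1 := by ring
      _ ≤ max C₁ 0 * (M * N ^ 2 / Rd ^ 2) * L ^ 4 := mul_le_mul_of_nonneg_left hL4 (by positivity)
      _ = _ := by ring
  -- (B)
  have hB : Q * (4 * N ^ 2) * (8 / K) ≤ M * N ^ 2 * L ^ 4 / Rd ^ 2 := by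
    have hx₃' : 64 * CQ ≤ x ^ (2 * κ / 5) := by have := hx₃ x hxx₃; rwa [pow_zero, mul_one] at this
    have hB1 : 64 * CQ * x ^ (7 * ε) * Rd ^ 2 ≤ x ^ κ := by
      calc _ ≤ x ^ (2 * κ / 5) * x ^ (7 * ε) * x ^ (2 * δ) := by gcongr
        _ = x ^ (2 * κ / 5 + 7 * ε + 2 * δ) := by rw [← Real.rpow_add hx0, ← Real.rpow_add hx0]
        _ ≤ x ^ κ := hmono (by linarith only [hεκ, hδκ])
    have hK2 : 8 / (K : ℝ) ≤ 16 * (x ^ κ)⁻¹ := by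
      rw [div_le_iff₀ hKpos]
      have : 16 * (x ^ κ)⁻¹ * K ≥ 16 * (x ^ κ)⁻¹ * (x ^ κ / 2) :=
        mul_le_mul_of_nonneg_left hKge (by positivity)
      have e : 16 * (x ^ κ)⁻¹ * (x ^ κ / 2) = 8 := by field_simp; ring
      linarith only [this, e]
    have h2 : 64 * CQ * x ^ (7 * ε) * (x ^ κ)⁻¹ ≤ (Rd ^ 2)⁻¹ := by
      rw [← div_eq_mul_inv, ← one_div, div_le_div_iff₀ (by positivity) (by positivity), one_mul]
      exact hB1
    calc Q * (4 * N ^ 2) * (8 / K) ≤ Q * (4 * N ^ 2) * (16 * (x ^ κ)⁻¹) :=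
          mul_le_mul_of_nonneg_left hK2 (by positivity)
      _ ≤ (CQ * x ^ (7 * ε) * M * L ^ 2) * (4 * N ^ 2) * (16 * (x ^ κ)⁻¹) := by gcongr
      _ = (64 * CQ * x ^ (7 * ε) * (x ^ κ)⁻¹) * (M * N ^ 2 * L ^ 2) := by ring
      _ ≤ (Rd ^ 2)⁻¹ * (M * N ^ 2 * L ^ 2) := mul_le_mul_of_nonneg_right h2 (by positivity)
      _ = (M * N ^ 2 / Rd ^ 2) * L ^ 2 := by ring
      _ ≤ (M * N ^ 2 / Rd ^ 2) * L ^ 4 := mul_le_mul_of_nonneg_left hL24 (by positivity)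
      _ = _ := by ring
  -- (C)
  have hC : Q * (42 * N * L ^ 2) ≤ M * N ^ 2 * L ^ 4 / Rd ^ 2 := by
    have hx₄' : 42 * CQ ≤ x ^ (η / 2) := by have := hx₄ x hxx₄; rwa [pow_zero, mul_one] at this
    have hC1 : 42 * CQ * x ^ (7 * ε) * Rd ^ 2 ≤ N := by
      calc _ ≤ x ^ (η / 2) * x ^ (7 * ε) * x ^ (2 * δ) := by gcongr
        _ = x ^ (η / 2 + 7 * ε + 2 * δ) := by rw [← Real.rpow_add hx0, ← Real.rpow_add hx0]
        _ ≤ x ^ η := hmono (by linarith only [hεη, hδη, hη])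
        _ ≤ N := hN
    have h2 : 42 * CQ * x ^ (7 * ε) ≤ N / Rd ^ 2 := by
      rw [le_div_iff₀ (by positivity)]; exact hC1
    calc Q * (42 * N * L ^ 2) ≤ (CQ * x ^ (7 * ε) * M * L ^ 2) * (42 * N * L ^ 2) := by gcongr
      _ = (42 * CQ * x ^ (7 * ε)) * (M * N * L ^ 4) := by ring
      _ ≤ (N / Rd ^ 2) * (M * N * L ^ 4) := mul_le_mul_of_nonneg_right h2 (by positivity)
      _ = _ := by ring
  -- (D)
  have hD : (L₀ : ℝ) * Xn * TW ≤ M * N ^ 2 * L ^ 4 / Rd ^ 2 := by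
    have habs := hx₂ x hxx₂
    rw [← hLdef] at habs
    have hS3 : S ^ 3 ≤ x ^ (153 / 100 : ℝ) := by
      calc S ^ 3 ≤ (x ^ (1 / 2 + δ)) ^ 3 := pow_le_pow_left₀ hS0.le hSx 3
        _ = x ^ ((1 / 2 + δ) * 3) := by rw [← Real.rpow_natCast, ← Real.rpow_mul hx0.le]; norm_num
        _ ≤ x ^ (153 / 100 : ℝ) := hmono (by linarith only [hδ1])
    have h1 : (L₀ : ℝ) * Xn * TW * Rd ^ 2 ≤ M * N ^ 2 := by
      calc (L₀ : ℝ) * Xn * TW * Rd ^ 2 ≤ (3 * S) * (2 * N) * ((3 * S) * (3 * S) *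
            ((CB * N * L ^ cd) ^ 2 * (2 * (2 ^ (nI + 1) * BFI.derivConst nI) * x ^ (-6 : ℝ)))) *
            x ^ (1 / 50 : ℝ) := by
            rw [hTWdef]; gcongr
        _ = (108 * CB ^ 2 * (2 ^ (nI + 1) * BFI.derivConst nI) * L ^ (2 * cd)) *
              (S ^ 3 * N * x ^ (-6 : ℝ) * x ^ (1 / 50 : ℝ)) * N ^ 2 := by ring
        _ ≤ x ^ (1 / 2 : ℝ) * (x ^ (153 / 100 : ℝ) * x * x ^ (-6 : ℝ) * x ^ (1 / 50 : ℝ)) * N ^ 2 := by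
            gcongr
        _ = x ^ (-(59 / 20) : ℝ) * N ^ 2 := by
            have e : x ^ (1 / 2 : ℝ) * (x ^ (153 / 100 : ℝ) * x * x ^ (-6 : ℝ) * x ^ (1 / 50 : ℝ)) =
                x ^ (-(59 / 20) : ℝ) := by
              conv_lhs => rw [show x ^ (153 / 100 : ℝ) * x = x ^ (153 / 100 : ℝ) * x ^ (1 : ℝ) by
                rw [Real.rpow_one]]
              rw [← Real.rpow_add hx0, ← Real.rpow_add hx0, ← Real.rpow_add hx0, ← Real.rpow_add hx0]
              norm_num
            rw [e]
        _ ≤ M * N ^ 2 := mul_le_mul_of_nonneg_right ((hmono (by norm_num)).trans hMhalf) (by positivity)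
    calc (L₀ : ℝ) * Xn * TW ≤ M * N ^ 2 / Rd ^ 2 := by rw [le_div_iff₀ (by positivity)]; exact h1
      _ = (M * N ^ 2 / Rd ^ 2) * 1 := (mul_one _).symm
      _ ≤ (M * N ^ 2 / Rd ^ 2) * L ^ 4 := mul_le_mul_of_nonneg_left hL4 (by positivity)
      _ = _ := by ring
  -- ### conclusion
  rw [hSD, show (4 : ℝ) = ((4 : ℕ) : ℝ) by norm_num, Real.rpow_natCast]
  have e : (max C₁ 0 + 3) * M * N ^ 2 * L ^ 4 / Rd ^ 2 =
      max C₁ 0 * (M * N ^ 2 * L ^ 4 / Rd ^ 2) + M * N ^ 2 * L ^ 4 / Rd ^ 2 +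
        M * N ^ 2 * L ^ 4 / Rd ^ 2 + M * N ^ 2 * L ^ 4 / Rd ^ 2 := by ring
  rw [e]
  linarith only [hSA, hSB, hSC, hA, hB, hC, hD]


/-- **§5.4, second reduction** (uniform `ε₁, κ`; kept for the record — the paper's argument gives
`ε₁, κ` depending on `η`, see `R1_of_R1small'`). [cite: Drappeau2017, §5.4] -/
theorem R1_of_R1small
    (HR1small : ∃ ε₁ κ : ℝ, 0 < ε₁ ∧ 0 < κ ∧ ∀ η : ℝ, 0 < η → ∃ δ : ℝ, 0 < δ ∧ ∀ Aτ : ℝ, 0 ≤ Aτ →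
      ∃ C x₀ : ℝ, ∀ x : ℝ, x₀ ≤ x →
      ∀ M N S Rd Y : ℝ, M * N = x → x ^ η ≤ N → N ≤ S ^ (2 / 3 - η) → x ^ (1 / 4 : ℝ) ≤ S →
        S ≤ x ^ (1 / 2 + δ) → 1 ≤ Rd → Rd ≤ x ^ δ → S * x ^ (-δ) ≤ Y → Y ≤ S / 4 →
      ∀ a₁ a₂ : ℤ, a₁ ≠ 0 → a₂ ≠ 0 → (|a₁| : ℝ) ≤ x ^ δ → (|a₂| : ℝ) ≤ x ^ δ →
      ∀ β : ℕ → ℂ, (∀ n, ‖β n‖ ≤ (σ 0 n : ℝ) ^ Aτ) → (∀ n, ¬Squarefree n → β n = 0) →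
      ∀ q₀ n₀ : ℕ, 0 < q₀ → (q₀ : ℝ) ≤ x ^ κ → 0 < n₀ → (n₀ : ℝ) ≤ x ^ κ → Nat.Coprime q₀ n₀ →
        IsCoprime (q₀ : ℤ) (a₁ * a₂) → IsCoprime (n₀ : ℤ) a₂ →
        ‖∑ q₁ ∈ ((BFI.mRange S Y).filter (fun q : ℕ => 0 < q)).filter
              (fun q : ℕ => IsCoprime (q : ℤ) (a₁ * a₂)),
          ∑ q₂ ∈ ((BFI.mRange S Y).filter (fun q : ℕ => 0 < q)).filter
              (fun q : ℕ => IsCoprime (q : ℤ) (a₁ * a₂)),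
            ((BFI.bump S Y q₁ : ℝ) : ℂ) * ((BFI.bump S Y q₂ : ℝ) : ℂ) *
            ∑ n₁ ∈ (BFI.dyadic N).filter (fun n : ℕ => IsCoprime (n : ℤ) a₂),
              ∑ n₂ ∈ (BFI.dyadic N).filter (fun n : ℕ => IsCoprime (n : ℤ) a₂),
                (if (Nat.gcd q₁ q₂ = q₀ ∧ Nat.gcd n₁ n₂ = n₀) then (1 : ℂ) else 0) *
                  (β n₁ * starRingEnd ℂ (β n₂)) *
                ((M : ℂ) / (Nat.lcm q₁ q₂ : ℂ) *
                  ∑ b ∈ (Finset.range (Nat.lcm q₁ q₂)).filter (fun b : ℕ =>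
                      (b : ZMod q₁) * ((n₁ : ZMod q₁) * (a₂ : ZMod q₁)) = (a₁ : ZMod q₁) ∧
                      (b : ZMod q₂) * ((n₂ : ZMod q₂) * (a₂ : ZMod q₂)) = (a₁ : ZMod q₂)),
                    ∑ h ∈ Finset.Icc (-(⌈(3 * S) ^ 2 * x ^ ε₁ / M⌉₊ : ℤ)) ⌈(3 * S) ^ 2 * x ^ ε₁ / M⌉₊,
                      (if ((Nat.lcm q₁ q₂ : ℕ) : ℤ) ∣ h then 0 else
                        𝓕 (BFI.bumpC 1 (1 / 2)) (M * h / (Nat.lcm q₁ q₂ : ℕ)) *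
                          (𝐞 ((b : ℝ) * h / (Nat.lcm q₁ q₂ : ℕ)) : ℂ)))‖ ≤
          C * M * N ^ 2 * x ^ (-3 * κ)) :
    ∃ ε₁ : ℝ, 0 < ε₁ ∧ ∀ η : ℝ, 0 < η → ∃ δ : ℝ, 0 < δ ∧ ∀ Aτ : ℝ, 0 ≤ Aτ →
      ∃ C c₀ x₀ : ℝ, ∀ x : ℝ, x₀ ≤ x →
      ∀ M N S Rd Y : ℝ, M * N = x → x ^ η ≤ N → N ≤ S ^ (2 / 3 - η) → x ^ (1 / 4 : ℝ) ≤ S →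
        S ≤ x ^ (1 / 2 + δ) → 1 ≤ Rd → Rd ≤ x ^ δ → S * x ^ (-δ) ≤ Y → Y ≤ S / 4 →
      ∀ a₁ a₂ : ℤ, a₁ ≠ 0 → a₂ ≠ 0 → (|a₁| : ℝ) ≤ x ^ δ → (|a₂| : ℝ) ≤ x ^ δ →
      ∀ β : ℕ → ℂ, (∀ n, ‖β n‖ ≤ (σ 0 n : ℝ) ^ Aτ) → (∀ n, ¬Squarefree n → β n = 0) →
        ‖∑ q₁ ∈ ((BFI.mRange S Y).filter (fun q : ℕ => 0 < q)).filter
              (fun q : ℕ => IsCoprime (q : ℤ) (a₁ * a₂)),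
          ∑ q₂ ∈ ((BFI.mRange S Y).filter (fun q : ℕ => 0 < q)).filter
              (fun q : ℕ => IsCoprime (q : ℤ) (a₁ * a₂)),
            ((BFI.bump S Y q₁ : ℝ) : ℂ) * ((BFI.bump S Y q₂ : ℝ) : ℂ) *
            ∑ n₁ ∈ (BFI.dyadic N).filter (fun n : ℕ => IsCoprime (n : ℤ) a₂),
              ∑ n₂ ∈ (BFI.dyadic N).filter (fun n : ℕ => IsCoprime (n : ℤ) a₂),
                β n₁ * starRingEnd ℂ (β n₂) *
                ((M : ℂ) / (Nat.lcm q₁ q₂ : ℂ) *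
                  ∑ b ∈ (Finset.range (Nat.lcm q₁ q₂)).filter (fun b : ℕ =>
                      (b : ZMod q₁) * ((n₁ : ZMod q₁) * (a₂ : ZMod q₁)) = (a₁ : ZMod q₁) ∧
                      (b : ZMod q₂) * ((n₂ : ZMod q₂) * (a₂ : ZMod q₂)) = (a₁ : ZMod q₂)),
                    ∑ h ∈ Finset.Icc (-(⌈(3 * S) ^ 2 * x ^ ε₁ / M⌉₊ : ℤ)) ⌈(3 * S) ^ 2 * x ^ ε₁ / M⌉₊,
                      (if ((Nat.lcm q₁ q₂ : ℕ) : ℤ) ∣ h then 0 else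
                        𝓕 (BFI.bumpC 1 (1 / 2)) (M * h / (Nat.lcm q₁ q₂ : ℕ)) *
                          (𝐞 ((b : ℝ) * h / (Nat.lcm q₁ q₂ : ℕ)) : ℂ)))‖ ≤
          C * M * N ^ 2 * Real.log x ^ c₀ / Rd ^ 2 := by
  obtain ⟨ε₁, κ, hε₁, hκ, HR⟩ := HR1small
  exact ⟨ε₁, hε₁, fun η hη => R1_of_R1small_core hε₁ hκ hη (HR η hη)⟩

/-- **§5.4, second reduction, with the quantifier order the paper's argument delivers**: the saving
coming from Theorem 2.1 is `x^{−η/2+O(δ)}` (p. 21), so the auxiliary exponents `ε₁` (cut-off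
`H = ⌈(3S)²x^{ε₁}/M⌉`), `κ` (good `q₀, n₀ ≤ x^κ`, saving `x^{−3κ}`) and `δ` are chosen AFTER `η`.
If for every `η > 0` there are such `ε₁, κ, δ > 0` for which the pieces `ℛ₁(q₀,n₀)` are
`O(MN²x^{−3κ})`, then the hypothesis of `Drappeau2017_theorem51_of_R1'` holds. [cite: Drappeau2017, §5.4] -/
theorem R1_of_R1small'
    (HR1small : ∀ η : ℝ, 0 < η → ∃ ε₁ κ δ : ℝ, 0 < ε₁ ∧ 0 < κ ∧ 0 < δ ∧ ∀ Aτ : ℝ, 0 ≤ Aτ →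
      ∃ C x₀ : ℝ, ∀ x : ℝ, x₀ ≤ x →
      ∀ M N S Rd Y : ℝ, M * N = x → x ^ η ≤ N → N ≤ S ^ (2 / 3 - η) → x ^ (1 / 4 : ℝ) ≤ S →
        S ≤ x ^ (1 / 2 + δ) → 1 ≤ Rd → Rd ≤ x ^ δ → S * x ^ (-δ) ≤ Y → Y ≤ S / 4 →
      ∀ a₁ a₂ : ℤ, a₁ ≠ 0 → a₂ ≠ 0 → (|a₁| : ℝ) ≤ x ^ δ → (|a₂| : ℝ) ≤ x ^ δ →
      ∀ β : ℕ → ℂ, (∀ n, ‖β n‖ ≤ (σ 0 n : ℝ) ^ Aτ) → (∀ n, ¬Squarefree n → β n = 0) →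
      ∀ q₀ n₀ : ℕ, 0 < q₀ → (q₀ : ℝ) ≤ x ^ κ → 0 < n₀ → (n₀ : ℝ) ≤ x ^ κ → Nat.Coprime q₀ n₀ →
        IsCoprime (q₀ : ℤ) (a₁ * a₂) → IsCoprime (n₀ : ℤ) a₂ →
        ‖∑ q₁ ∈ ((BFI.mRange S Y).filter (fun q : ℕ => 0 < q)).filter
              (fun q : ℕ => IsCoprime (q : ℤ) (a₁ * a₂)),
          ∑ q₂ ∈ ((BFI.mRange S Y).filter (fun q : ℕ => 0 < q)).filter
              (fun q : ℕ => IsCoprime (q : ℤ) (a₁ * a₂)),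
            ((BFI.bump S Y q₁ : ℝ) : ℂ) * ((BFI.bump S Y q₂ : ℝ) : ℂ) *
            ∑ n₁ ∈ (BFI.dyadic N).filter (fun n : ℕ => IsCoprime (n : ℤ) a₂),
              ∑ n₂ ∈ (BFI.dyadic N).filter (fun n : ℕ => IsCoprime (n : ℤ) a₂),
                (if (Nat.gcd q₁ q₂ = q₀ ∧ Nat.gcd n₁ n₂ = n₀) then (1 : ℂ) else 0) *
                  (β n₁ * starRingEnd ℂ (β n₂)) *
                ((M : ℂ) / (Nat.lcm q₁ q₂ : ℂ) *
                  ∑ b ∈ (Finset.range (Nat.lcm q₁ q₂)).filter (fun b : ℕ =>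
                      (b : ZMod q₁) * ((n₁ : ZMod q₁) * (a₂ : ZMod q₁)) = (a₁ : ZMod q₁) ∧
                      (b : ZMod q₂) * ((n₂ : ZMod q₂) * (a₂ : ZMod q₂)) = (a₁ : ZMod q₂)),
                    ∑ h ∈ Finset.Icc (-(⌈(3 * S) ^ 2 * x ^ ε₁ / M⌉₊ : ℤ)) ⌈(3 * S) ^ 2 * x ^ ε₁ / M⌉₊,
                      (if ((Nat.lcm q₁ q₂ : ℕ) : ℤ) ∣ h then 0 else
                        𝓕 (BFI.bumpC 1 (1 / 2)) (M * h / (Nat.lcm q₁ q₂ : ℕ)) *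
                          (𝐞 ((b : ℝ) * h / (Nat.lcm q₁ q₂ : ℕ)) : ℂ)))‖ ≤
          C * M * N ^ 2 * x ^ (-3 * κ)) :
    ∀ η : ℝ, 0 < η → ∃ ε₁ δ : ℝ, 0 < ε₁ ∧ 0 < δ ∧ ∀ Aτ : ℝ, 0 ≤ Aτ →
      ∃ C c₀ x₀ : ℝ, ∀ x : ℝ, x₀ ≤ x →
      ∀ M N S Rd Y : ℝ, M * N = x → x ^ η ≤ N → N ≤ S ^ (2 / 3 - η) → x ^ (1 / 4 : ℝ) ≤ S →
        S ≤ x ^ (1 / 2 + δ) → 1 ≤ Rd → Rd ≤ x ^ δ → S * x ^ (-δ) ≤ Y → Y ≤ S / 4 →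
      ∀ a₁ a₂ : ℤ, a₁ ≠ 0 → a₂ ≠ 0 → (|a₁| : ℝ) ≤ x ^ δ → (|a₂| : ℝ) ≤ x ^ δ →
      ∀ β : ℕ → ℂ, (∀ n, ‖β n‖ ≤ (σ 0 n : ℝ) ^ Aτ) → (∀ n, ¬Squarefree n → β n = 0) →
        ‖∑ q₁ ∈ ((BFI.mRange S Y).filter (fun q : ℕ => 0 < q)).filter
              (fun q : ℕ => IsCoprime (q : ℤ) (a₁ * a₂)),
          ∑ q₂ ∈ ((BFI.mRange S Y).filter (fun q : ℕ => 0 < q)).filter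
              (fun q : ℕ => IsCoprime (q : ℤ) (a₁ * a₂)),
            ((BFI.bump S Y q₁ : ℝ) : ℂ) * ((BFI.bump S Y q₂ : ℝ) : ℂ) *
            ∑ n₁ ∈ (BFI.dyadic N).filter (fun n : ℕ => IsCoprime (n : ℤ) a₂),
              ∑ n₂ ∈ (BFI.dyadic N).filter (fun n : ℕ => IsCoprime (n : ℤ) a₂),
                β n₁ * starRingEnd ℂ (β n₂) *
                ((M : ℂ) / (Nat.lcm q₁ q₂ : ℂ) *
                  ∑ b ∈ (Finset.range (Nat.lcm q₁ q₂)).filter (fun b : ℕ =>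
                      (b : ZMod q₁) * ((n₁ : ZMod q₁) * (a₂ : ZMod q₁)) = (a₁ : ZMod q₁) ∧
                      (b : ZMod q₂) * ((n₂ : ZMod q₂) * (a₂ : ZMod q₂)) = (a₁ : ZMod q₂)),
                    ∑ h ∈ Finset.Icc (-(⌈(3 * S) ^ 2 * x ^ ε₁ / M⌉₊ : ℤ)) ⌈(3 * S) ^ 2 * x ^ ε₁ / M⌉₊,
                      (if ((Nat.lcm q₁ q₂ : ℕ) : ℤ) ∣ h then 0 else
                        𝓕 (BFI.bumpC 1 (1 / 2)) (M * h / (Nat.lcm q₁ q₂ : ℕ)) *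
                          (𝐞 ((b : ℝ) * h / (Nat.lcm q₁ q₂ : ℕ)) : ℂ)))‖ ≤
          C * M * N ^ 2 * Real.log x ^ c₀ / Rd ^ 2 := by
  intro η hη
  obtain ⟨ε₁, κ, δ₁, hε₁, hκ, hδ₁, H⟩ := HR1small η hη
  obtain ⟨δ, hδ, H'⟩ := R1_of_R1small_core hε₁ hκ hη ⟨δ₁, hδ₁, H⟩
  exact ⟨ε₁, δ, hε₁, hδ, H'⟩

end Drappeau2017

/-- **Drappeau 2017, Theorem 5.1 from the bound for the pieces `ℛ₁(q₀,n₀)` with small good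
`(q₀,n₀)`** (§5.4 of the paper, second reduction): it remains to bound, for `q₀, n₀ ≤ x^κ` with
`(q₀,n₀) = (q₀,a₁a₂) = (n₀,a₂) = 1`, the piece `ℛ₁^{wt,≤H}(q₀,n₀)` of the truncated frequency sum
by `O(MN²x^{−3κ})` — the content of (5.23)–(5.24) and Theorem 2.1 of the paper.
[cite: Drappeau2017, §5.4, Theorem 5.1] -/
theorem Drappeau2017_theorem51_of_R1small
    (HR1small : ∃ ε₁ κ : ℝ, 0 < ε₁ ∧ 0 < κ ∧ ∀ η : ℝ, 0 < η → ∃ δ : ℝ, 0 < δ ∧ ∀ Aτ : ℝ, 0 ≤ Aτ →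
      ∃ C x₀ : ℝ, ∀ x : ℝ, x₀ ≤ x →
      ∀ M N S Rd Y : ℝ, M * N = x → x ^ η ≤ N → N ≤ S ^ (2 / 3 - η) → x ^ (1 / 4 : ℝ) ≤ S →
        S ≤ x ^ (1 / 2 + δ) → 1 ≤ Rd → Rd ≤ x ^ δ → S * x ^ (-δ) ≤ Y → Y ≤ S / 4 →
      ∀ a₁ a₂ : ℤ, a₁ ≠ 0 → a₂ ≠ 0 → (|a₁| : ℝ) ≤ x ^ δ → (|a₂| : ℝ) ≤ x ^ δ →
      ∀ β : ℕ → ℂ, (∀ n, ‖β n‖ ≤ (σ 0 n : ℝ) ^ Aτ) → (∀ n, ¬Squarefree n → β n = 0) →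
      ∀ q₀ n₀ : ℕ, 0 < q₀ → (q₀ : ℝ) ≤ x ^ κ → 0 < n₀ → (n₀ : ℝ) ≤ x ^ κ → Nat.Coprime q₀ n₀ →
        IsCoprime (q₀ : ℤ) (a₁ * a₂) → IsCoprime (n₀ : ℤ) a₂ →
        ‖∑ q₁ ∈ ((BFI.mRange S Y).filter (fun q : ℕ => 0 < q)).filter
              (fun q : ℕ => IsCoprime (q : ℤ) (a₁ * a₂)),
          ∑ q₂ ∈ ((BFI.mRange S Y).filter (fun q : ℕ => 0 < q)).filter
              (fun q : ℕ => IsCoprime (q : ℤ) (a₁ * a₂)),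
            ((BFI.bump S Y q₁ : ℝ) : ℂ) * ((BFI.bump S Y q₂ : ℝ) : ℂ) *
            ∑ n₁ ∈ (BFI.dyadic N).filter (fun n : ℕ => IsCoprime (n : ℤ) a₂),
              ∑ n₂ ∈ (BFI.dyadic N).filter (fun n : ℕ => IsCoprime (n : ℤ) a₂),
                (if (Nat.gcd q₁ q₂ = q₀ ∧ Nat.gcd n₁ n₂ = n₀) then (1 : ℂ) else 0) *
                  (β n₁ * starRingEnd ℂ (β n₂)) *
                ((M : ℂ) / (Nat.lcm q₁ q₂ : ℂ) *
                  ∑ b ∈ (Finset.range (Nat.lcm q₁ q₂)).filter (fun b : ℕ =>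
                      (b : ZMod q₁) * ((n₁ : ZMod q₁) * (a₂ : ZMod q₁)) = (a₁ : ZMod q₁) ∧
                      (b : ZMod q₂) * ((n₂ : ZMod q₂) * (a₂ : ZMod q₂)) = (a₁ : ZMod q₂)),
                    ∑ h ∈ Finset.Icc (-(⌈(3 * S) ^ 2 * x ^ ε₁ / M⌉₊ : ℤ)) ⌈(3 * S) ^ 2 * x ^ ε₁ / M⌉₊,
                      (if ((Nat.lcm q₁ q₂ : ℕ) : ℤ) ∣ h then 0 else
                        𝓕 (BFI.bumpC 1 (1 / 2)) (M * h / (Nat.lcm q₁ q₂ : ℕ)) *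
                          (𝐞 ((b : ℝ) * h / (Nat.lcm q₁ q₂ : ℕ)) : ℂ)))‖ ≤
          C * M * N ^ 2 * x ^ (-3 * κ)) :
    Drappeau2017_theorem51 :=
  Drappeau2017_theorem51_of_R1 (Drappeau2017.R1_of_R1small HR1small)

/-- **Theorem 5.1 from the pieces `ℛ₁(q₀,n₀)`** — quantifier order as delivered by the paper
(`ε₁, κ, δ` depending on `η`); see `Drappeau2017.R1_of_R1small'`. [cite: Drappeau2017, §5.4, Theorem 5.1] -/
theorem Drappeau2017_theorem51_of_R1small'
    (HR1small : ∀ η : ℝ, 0 < η → ∃ ε₁ κ δ : ℝ, 0 < ε₁ ∧ 0 < κ ∧ 0 < δ ∧ ∀ Aτ : ℝ, 0 ≤ Aτ →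
      ∃ C x₀ : ℝ, ∀ x : ℝ, x₀ ≤ x →
      ∀ M N S Rd Y : ℝ, M * N = x → x ^ η ≤ N → N ≤ S ^ (2 / 3 - η) → x ^ (1 / 4 : ℝ) ≤ S →
        S ≤ x ^ (1 / 2 + δ) → 1 ≤ Rd → Rd ≤ x ^ δ → S * x ^ (-δ) ≤ Y → Y ≤ S / 4 →
      ∀ a₁ a₂ : ℤ, a₁ ≠ 0 → a₂ ≠ 0 → (|a₁| : ℝ) ≤ x ^ δ → (|a₂| : ℝ) ≤ x ^ δ →
      ∀ β : ℕ → ℂ, (∀ n, ‖β n‖ ≤ (σ 0 n : ℝ) ^ Aτ) → (∀ n, ¬Squarefree n → β n = 0) →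
      ∀ q₀ n₀ : ℕ, 0 < q₀ → (q₀ : ℝ) ≤ x ^ κ → 0 < n₀ → (n₀ : ℝ) ≤ x ^ κ → Nat.Coprime q₀ n₀ →
        IsCoprime (q₀ : ℤ) (a₁ * a₂) → IsCoprime (n₀ : ℤ) a₂ →
        ‖∑ q₁ ∈ ((BFI.mRange S Y).filter (fun q : ℕ => 0 < q)).filter
              (fun q : ℕ => IsCoprime (q : ℤ) (a₁ * a₂)),
          ∑ q₂ ∈ ((BFI.mRange S Y).filter (fun q : ℕ => 0 < q)).filter
              (fun q : ℕ => IsCoprime (q : ℤ) (a₁ * a₂)),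
            ((BFI.bump S Y q₁ : ℝ) : ℂ) * ((BFI.bump S Y q₂ : ℝ) : ℂ) *
            ∑ n₁ ∈ (BFI.dyadic N).filter (fun n : ℕ => IsCoprime (n : ℤ) a₂),
              ∑ n₂ ∈ (BFI.dyadic N).filter (fun n : ℕ => IsCoprime (n : ℤ) a₂),
                (if (Nat.gcd q₁ q₂ = q₀ ∧ Nat.gcd n₁ n₂ = n₀) then (1 : ℂ) else 0) *
                  (β n₁ * starRingEnd ℂ (β n₂)) *
                ((M : ℂ) / (Nat.lcm q₁ q₂ : ℂ) *
                  ∑ b ∈ (Finset.range (Nat.lcm q₁ q₂)).filter (fun b : ℕ =>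
                      (b : ZMod q₁) * ((n₁ : ZMod q₁) * (a₂ : ZMod q₁)) = (a₁ : ZMod q₁) ∧
                      (b : ZMod q₂) * ((n₂ : ZMod q₂) * (a₂ : ZMod q₂)) = (a₁ : ZMod q₂)),
                    ∑ h ∈ Finset.Icc (-(⌈(3 * S) ^ 2 * x ^ ε₁ / M⌉₊ : ℤ)) ⌈(3 * S) ^ 2 * x ^ ε₁ / M⌉₊,
                      (if ((Nat.lcm q₁ q₂ : ℕ) : ℤ) ∣ h then 0 else
                        𝓕 (BFI.bumpC 1 (1 / 2)) (M * h / (Nat.lcm q₁ q₂ : ℕ)) *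
                          (𝐞 ((b : ℝ) * h / (Nat.lcm q₁ q₂ : ℕ)) : ℂ)))‖ ≤
          C * M * N ^ 2 * x ^ (-3 * κ)) :
    Drappeau2017_theorem51 :=
  Drappeau2017_theorem51_of_R1' (Drappeau2017.R1_of_R1small' HR1small)

end Literature.NumberTheory.Sieve

end
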